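import Mathlib.Analysis.Polynomial.MahlerMeasure
import Mathlib.NumberTheory.MahlerMeasure
import Mathlib.RingTheory.Polynomial.Resultant.Basic
import Mathlib.RingTheory.Polynomial.GaussLemma
import Mathlib.RingTheory.PrincipalIdealDomain
import Literature.NumberTheory.Transcendental.GelfondCriterion
import HarnessLib

/-!
# Gelfond's transcendence criterion — proof (with an unoptimised constant)

Topic `Literature/NumberTheory/Transcendental` (trunk T-TRANSCEND). Node [B'] of the decomposition of
`Literature.NumberTheory.Transcendental.chudnovsky` (see `ChudnovskyPeriods.lean`, `GelfondCriterion.lean`).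

`GelfondCriterion.lean` vendors Chudnovsky 1984, Ch. 4, Lemma 1.1 (Brownawell–Waldschmidt form of
Gelfond's lemma) as a named fact with the printed constant: `|P_N(θ)| < exp(-6aδ_Nσ_N)`. Here we
**prove** the same statement with the constant `6` replaced by `40`
(`Literature.NumberTheory.Transcendental.gelfond_criterion`); this is all that the applications in Ch. 7 need (there the
upper bound available is `exp(-γ L³)` against `δ_N σ_N = O(L² log L)`), and it is the form fed
into the proof of Chudnovsky's theorem on periods. The proof is the classical one
(Gelfond 1949/1952, Ch. III §4, Lemma VII; Brownawell 1974; Waldschmidt 1974, LNM 402, Ch. 5):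

1. *Extraction.* With the additive weight `w(Q) = δ (log M(Q) + deg Q) + σ deg Q` (`M` = Mahler
   measure, so that `w(Q₁Q₂) = w(Q₁) + w(Q₂)` and `w(Q) ≥ δ log H(Q) + σ deg Q` by
   `H(Q) ≤ 2^{deg Q} M(Q)`), a bound `|P(θ)| < e^{-ρ w(P)}` descends to some irreducible
   nonconstant factor `Q ∣ P`: `|Q(θ)| < e^{-ρ w(Q)}` (induction on the factorisation,
   `WfDvdMonoid.induction_on_irreducible`).
2. *Comparison.* Two coprime integer polynomials cannot both be very small at `θ`: their resultant
   is a nonzero integer, and `Res(f, g) = ∑_j w_j · (cofactor)` with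
   `w = (g(θ), θg(θ), …, f(θ), θf(θ), …)` (row operations on the Sylvester matrix), the cofactors
   being bounded by the column-sum bound `|det A| ≤ ∏_j ∑_i |A_{ij}|`
   (`Matrix.norm_det_le_prod_sum_norm`). Hence the irreducible factors extracted from `P_N` and
   `P_{N+1}` coincide, so they are all equal to one `Q`.
3. `|Q(θ)| < e^{-ρσ_N} → 0`, so `Q(θ) = 0`: `θ` is algebraic and `P_N(θ) = 0` for `N ≥ N₀`.

## Contents (helper definitions `Polynomial.l1norm`, `Polynomial.gelfondWeight`; everything else is
proved; the Mahler measure is Mathlib's `Polynomial.logMahlerMeasure` of the complexification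
`Q.map (Int.castRingHom ℂ)`, i.e. `Real.log (Q.mapMahlerMeasure (Int.castRingHom ℂ))`)

* `Matrix.norm_det_le_prod_sum_norm` — `‖det A‖ ≤ ∏_j ∑_i ‖A i j‖` over `ℂ`.
* `Polynomial.one_le_norm_aeval_of_le` — `|Q(θ)| ≥ 1` if `|θ| ≥ 1 + H(Q)` (`Q ∈ ℤ[X]`, `Q ≠ 0`).
* `Polynomial.resultant_liouville` — for coprime `f, g ∈ ℤ[X]`:
  `1 ≤ (m+n) μ^{m+n} (1+‖g‖₁)^m (1+‖f‖₁)^n · max(|f(θ)|, |g(θ)|)`, `μ = max(1, |θ|)`.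
* `Polynomial.gelfondWeight`, `Polynomial.exists_irreducible_dvd_small` — the extraction step.
* `Polynomial.not_isCoprime_of_small`, `Polynomial.associated_of_not_isCoprime` — the
  comparison step.
* `Literature.NumberTheory.Transcendental.gelfond_criterion` — Lemma 1.1 with constant `40` (and
  `gelfond_criterion_of_le`, the case `δ_N ≤ σ_N` to which it reduces;
  `gelfond_criterion_not_small_values`, the contrapositive for transcendental `θ`).

The first part of the file proves the constant `40` (`gelfond_criterion`, through which the uses
in this tree go). The appendix (`## Appendix: the printed constant 6`) sharpens the bookkeeping
and **discharges the named fact** `Literature.NumberTheory.Transcendental.GelfondCriterion`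
(constant `6`, as printed): `GelfondCriterion_holds`. The two extra ingredients are

* `Polynomial.resultant_liouville_sharp` — for coprime `f, g ∈ ℤ[X]` and *every* `θ ∈ ℂ`:
  `1 ≤ ‖f‖₁^n ‖g‖₁^m (m |g(θ)| + n |f(θ)|)` (no power of `|θ|`: the identity
  `det S · v = (v S) · adj S` is read at the row `0` if `|θ| ≤ 1` and at the row `m+n-1` if
  `|θ| ≥ 1`; fine cofactor bound `Matrix.norm_adjugate_le_prod_erase`);
* `Polynomial.l1norm_le_two_pow_mul_mahlerMeasure` (`‖Q‖₁ ≤ 2^{deg Q} M(Q)`) and Landau's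
  inequality in the form `log M(P) ≤ deg P / 2 + log H(P)` (`logMahlerMeasure_map_le_half`),
  which give `w(P_N) < (5/2) δ_N σ_N`, so the extraction runs with `ρ = 12a/5`, and the comparison
  `Polynomial.not_isCoprime_of_small_sharp` closes with room to spare
  (`(3/2)a w - (12/5)a w = -(9/10)a w` against `log(2aσ)`, via `2y ≤ e^{9y/10}`).
-/

noncomputable section

open scoped Classical

open Polynomial Filter Finset Matrix

/-! ### A determinant bound -/

namespace Matrix

/-- **Column-sum bound for determinants**: `‖det A‖ ≤ ∏_j ∑_i ‖A i j‖` (expand the product: it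
contains every permutation term of the Leibniz formula, and all terms are nonnegative). [folklore] -/
theorem norm_det_le_prod_sum_norm {n : Type*} [Fintype n] [DecidableEq n] (A : Matrix n n ℂ) :
    ‖A.det‖ ≤ ∏ j, ∑ i, ‖A i j‖ := by
  rw [det_apply', Finset.prod_univ_sum]
  calc ‖∑ σ : Equiv.Perm n, ((Equiv.Perm.sign σ : ℤ) : ℂ) * ∏ i, A (σ i) i‖
      ≤ ∑ σ : Equiv.Perm n, ‖((Equiv.Perm.sign σ : ℤ) : ℂ) * ∏ i, A (σ i) i‖ := norm_sum_le _ _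
    _ = ∑ σ : Equiv.Perm n, ∏ i, ‖A (σ i) i‖ := by
        refine Finset.sum_congr rfl fun σ _ => ?_
        rw [norm_mul, norm_prod]
        rcases Int.units_eq_one_or (Equiv.Perm.sign σ) with h | h <;> simp [h]
    _ = ∑ p ∈ (Finset.univ : Finset (Equiv.Perm n)).map ⟨fun σ : Equiv.Perm n => (σ : n → n),
          fun σ τ h => Equiv.ext (congrFun h)⟩, ∏ i, ‖A (p i) i‖ := by
        rw [Finset.sum_map]
        rfl
    _ ≤ ∑ p ∈ Fintype.piFinset fun _ : n => (Finset.univ : Finset n), ∏ i, ‖A (p i) i‖ := by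
        refine Finset.sum_le_sum_of_subset_of_nonneg (fun p _ => ?_) fun p _ _ =>
          Finset.prod_nonneg fun i _ => norm_nonneg _
        simp

/-- Determinant bound after replacing one row by a standard basis vector: the column sums grow by
at most `1`. [folklore] -/
theorem norm_det_updateRow_single_le {n : Type*} [Fintype n] [DecidableEq n] (A : Matrix n n ℂ)
    (i₀ j₀ : n) (c : n → ℝ) (hc : ∀ j, ∑ i, ‖A i j‖ ≤ c j) :
    ‖(A.updateRow i₀ (Pi.single j₀ 1)).det‖ ≤ ∏ j, (1 + c j) := by
  refine (norm_det_le_prod_sum_norm _).trans (Finset.prod_le_prod (fun j _ => by positivity)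
    fun j _ => ?_)
  have hsplit : ∑ i, ‖A.updateRow i₀ (Pi.single j₀ 1) i j‖ =
      ‖(Pi.single j₀ (1 : ℂ) : n → ℂ) j‖ + ∑ i ∈ Finset.univ.erase i₀, ‖A i j‖ := by
    rw [← Finset.add_sum_erase _ _ (Finset.mem_univ i₀)]
    congr 1
    · simp
    · refine Finset.sum_congr rfl fun i hi => ?_
      rw [updateRow_ne (Finset.ne_of_mem_erase hi)]
  rw [hsplit]
  gcongr
  · by_cases h : j = j₀
    · subst h; simp
    · simp [h]
  · calc ∑ i ∈ Finset.univ.erase i₀, ‖A i j‖ ≤ ∑ i, ‖A i j‖ :=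
          Finset.sum_le_sum_of_subset_of_nonneg (Finset.erase_subset _ _) fun _ _ _ => norm_nonneg _
      _ ≤ c j := hc j

end Matrix

namespace Polynomial

/-! ### Integer polynomials: norms, heights, Mahler measure -/

/-- The `ℓ¹`-norm `∑ |a_i|` of an integer polynomial (as a real number). It is definitionally
`Q.sum fun _ a => ‖a‖`, the shape used by Mathlib (`Polynomial.mahlerMeasure_le_sum_norm_coeff`);
see `l1norm_eq_sum`. [folklore] -/
def l1norm (Q : ℤ[X]) : ℝ := ∑ i ∈ Q.support, ‖Q.coeff i‖

/-- `‖Q‖₁ = Q.sum fun _ a => ‖a‖` (Mathlib's spelling), by `rfl`. [folklore] -/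
lemma l1norm_eq_sum (Q : ℤ[X]) : Q.l1norm = Q.sum fun _ a => ‖a‖ := rfl

/-- `‖Q‖₁ ≥ 0`. [folklore] -/
lemma l1norm_nonneg (Q : ℤ[X]) : 0 ≤ Q.l1norm :=
  Finset.sum_nonneg fun _ _ => norm_nonneg _

/-- `‖Q‖₁ ≤ (deg Q + 1) H(Q)`. [folklore] -/
lemma l1norm_le (Q : ℤ[X]) : Q.l1norm ≤ (Q.natDegree + 1) * Q.supNorm := by
  unfold l1norm
  calc ∑ i ∈ Q.support, ‖Q.coeff i‖ ≤ ∑ i ∈ Finset.range (Q.natDegree + 1), ‖Q.coeff i‖ :=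
        Finset.sum_le_sum_of_subset_of_nonneg supp_subset_range_natDegree_succ
          fun _ _ _ => norm_nonneg _
    _ ≤ ∑ _i ∈ Finset.range (Q.natDegree + 1), Q.supNorm :=
        Finset.sum_le_sum fun i _ => Q.le_supNorm i
    _ = (Q.natDegree + 1) * Q.supNorm := by simp

/-- `|Q(θ)| ≤ ‖Q‖₁ · max(1,|θ|)^{deg Q}`. [folklore] -/
lemma norm_aeval_le_l1norm_mul (Q : ℤ[X]) (θ : ℂ) :
    ‖aeval θ Q‖ ≤ Q.l1norm * max 1 ‖θ‖ ^ Q.natDegree := by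
  rw [aeval_eq_sum_range, l1norm]
  calc ‖∑ i ∈ Finset.range (Q.natDegree + 1), Q.coeff i • θ ^ i‖
      ≤ ∑ i ∈ Finset.range (Q.natDegree + 1), ‖Q.coeff i • θ ^ i‖ := norm_sum_le _ _
    _ ≤ ∑ i ∈ Finset.range (Q.natDegree + 1), ‖Q.coeff i‖ * max 1 ‖θ‖ ^ Q.natDegree := by
        refine Finset.sum_le_sum fun i hi => ?_
        rw [zsmul_eq_mul, norm_mul, Complex.norm_intCast, norm_pow, ← Int.norm_eq_abs]
        gcongr
        · calc ‖θ‖ ^ i ≤ max 1 ‖θ‖ ^ i := by gcongr; exact le_max_right _ _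
            _ ≤ max 1 ‖θ‖ ^ Q.natDegree :=
              pow_le_pow_right₀ (le_max_left _ _) (Nat.lt_succ_iff.mp (Finset.mem_range.mp hi))
    _ = (∑ i ∈ Finset.range (Q.natDegree + 1), ‖Q.coeff i‖) * max 1 ‖θ‖ ^ Q.natDegree := by
        rw [Finset.sum_mul]
    _ = Q.l1norm * max 1 ‖θ‖ ^ Q.natDegree := by
        congr 1
        unfold l1norm
        refine (Finset.sum_subset supp_subset_range_natDegree_succ fun i _ hi => ?_).symm
        simp [notMem_support_iff.mp hi]

/-- If `|θ| ≥ 1 + H(Q)` for a nonzero integer polynomial `Q`, then `|Q(θ)| ≥ 1`: the leading term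
dominates, `|Q(θ)| ≥ |θ|^d - H(|θ|^d - 1)/(|θ| - 1) ≥ 1`. [folklore] -/
theorem one_le_norm_aeval_of_le {Q : ℤ[X]} (hQ : Q ≠ 0) {θ : ℂ} (hθ : 1 + Q.supNorm ≤ ‖θ‖) :
    1 ≤ ‖aeval θ Q‖ := by
  set r : ℝ := ‖θ‖ with hr
  have hH : 1 ≤ Q.supNorm := one_le_supNorm_of_ne_zero hQ
  have hr1 : 1 ≤ r - 1 := by linarith
  -- split off the leading term
  set a : ℂ := (Q.leadingCoeff : ℂ) * θ ^ Q.natDegree with ha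
  set b : ℂ := ∑ i ∈ Finset.range Q.natDegree, (Q.coeff i : ℂ) * θ ^ i with hb
  have hsplit : aeval θ Q = a + b := by
    rw [aeval_eq_sum_range, Finset.sum_range_succ, add_comm, ha, hb, ← coeff_natDegree]
    simp only [zsmul_eq_mul]
  have hlead : r ^ Q.natDegree ≤ ‖a‖ := by
    rw [ha, norm_mul, norm_pow, Complex.norm_intCast, ← hr]
    have : (1 : ℝ) ≤ |(Q.leadingCoeff : ℝ)| := by
      rw [← Int.cast_abs]
      exact_mod_cast Int.one_le_abs (leadingCoeff_ne_zero.mpr hQ)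
    calc r ^ Q.natDegree = 1 * r ^ Q.natDegree := (one_mul _).symm
      _ ≤ |(Q.leadingCoeff : ℝ)| * r ^ Q.natDegree := by gcongr
  have htail : ‖b‖ ≤ r ^ Q.natDegree - 1 := by
    have hgeom : (∑ i ∈ Finset.range Q.natDegree, r ^ i) * (r - 1) = r ^ Q.natDegree - 1 :=
      geom_sum_mul r Q.natDegree
    have hs0 : 0 ≤ ∑ i ∈ Finset.range Q.natDegree, r ^ i :=
      Finset.sum_nonneg fun i _ => by positivity
    calc ‖b‖ ≤ ∑ i ∈ Finset.range Q.natDegree, ‖(Q.coeff i : ℂ) * θ ^ i‖ := norm_sum_le _ _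
      _ ≤ ∑ i ∈ Finset.range Q.natDegree, Q.supNorm * r ^ i := by
          refine Finset.sum_le_sum fun i _ => ?_
          rw [norm_mul, norm_pow, Complex.norm_intCast, ← Int.norm_eq_abs, ← hr]
          gcongr
          exact Q.le_supNorm i
      _ = Q.supNorm * ∑ i ∈ Finset.range Q.natDegree, r ^ i := by rw [Finset.mul_sum]
      _ ≤ (r - 1) * ∑ i ∈ Finset.range Q.natDegree, r ^ i :=
          mul_le_mul_of_nonneg_right (by linarith) hs0
      _ = r ^ Q.natDegree - 1 := by rw [mul_comm, hgeom]
  rw [hsplit]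
  have h2 : ‖a‖ ≤ ‖a + b‖ + ‖b‖ :=
    calc ‖a‖ = ‖(a + b) - b‖ := by rw [add_sub_cancel_right]
      _ ≤ ‖a + b‖ + ‖b‖ := norm_sub_le _ _
  linarith

/-- Contrapositive form: a nonzero integer polynomial with `|Q(θ)| < 1` forces `|θ| < 1 + H(Q)`.
[folklore] -/
theorem norm_lt_one_add_supNorm {Q : ℤ[X]} (hQ : Q ≠ 0) {θ : ℂ} (h : ‖aeval θ Q‖ < 1) :
    ‖θ‖ < 1 + Q.supNorm := by
  by_contra hcon
  exact absurd (one_le_norm_aeval_of_le hQ (not_lt.mp hcon)) (not_le.mpr h)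

/-! The complexification `Q.map (Int.castRingHom ℂ)` of an integer polynomial and its Mahler
measure. We use Mathlib's `Polynomial.logMahlerMeasure` of the complexification, which is
`Real.log (Q.mapMahlerMeasure (Int.castRingHom ℂ))` (`Polynomial.mapMahlerMeasure`,
`Polynomial.logMahlerMeasure_eq_log_MahlerMeasure`); junk value `logMahlerMeasure 0 = 0`. -/

/-- `Q ≠ 0 ⇒ Q.map (Int.castRingHom ℂ) ≠ 0`. [folklore] -/
lemma map_intCastRingHom_ne_zero {Q : ℤ[X]} (hQ : Q ≠ 0) : Q.map (Int.castRingHom ℂ) ≠ 0 :=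
  (Polynomial.map_ne_zero_iff (RingHom.injective_int _)).mpr hQ

/-- Evaluating the complexification is `aeval`. [folklore] -/
lemma eval_map_intCastRingHom (Q : ℤ[X]) (θ : ℂ) :
    (Q.map (Int.castRingHom ℂ)).eval θ = aeval θ Q := by
  rw [aeval_def, eval_map]
  rfl

/-- Complexification preserves the degree. [folklore] -/
lemma natDegree_map_intCastRingHom (Q : ℤ[X]) :
    (Q.map (Int.castRingHom ℂ)).natDegree = Q.natDegree :=
  natDegree_map_eq_of_injective (RingHom.injective_int _) _

/-- Complexification preserves the naive height `Polynomial.supNorm` (Mathlib has no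
`supNorm_map`). [folklore] -/
lemma supNorm_map_intCastRingHom (Q : ℤ[X]) :
    (Q.map (Int.castRingHom ℂ)).supNorm = Q.supNorm := by
  rw [supNorm_eq_iSup, supNorm_eq_iSup]
  congr 1
  ext i
  simp [Int.norm_eq_abs]

/-- `log M(Q) ≥ 0` for `Q ≠ 0`. [folklore] -/
lemma logMahlerMeasure_map_nonneg {Q : ℤ[X]} (hQ : Q ≠ 0) :
    0 ≤ (Q.map (Int.castRingHom ℂ)).logMahlerMeasure := by
  rw [logMahlerMeasure_eq_log_MahlerMeasure]
  exact Real.log_nonneg (Polynomial.one_le_mahlerMeasure_of_ne_zero hQ)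

/-- Additivity: `log M(Q₁Q₂) = log M(Q₁) + log M(Q₂)` (Mathlib's
`logMahlerMeasure_mul_eq_add_logMahlerMeasure` in `ℤ[X]` form). [folklore] -/
lemma logMahlerMeasure_map_mul {Q₁ Q₂ : ℤ[X]} (h₁ : Q₁ ≠ 0) (h₂ : Q₂ ≠ 0) :
    ((Q₁ * Q₂).map (Int.castRingHom ℂ)).logMahlerMeasure =
      (Q₁.map (Int.castRingHom ℂ)).logMahlerMeasure +
        (Q₂.map (Int.castRingHom ℂ)).logMahlerMeasure := by
  rw [Polynomial.map_mul]
  exact logMahlerMeasure_mul_eq_add_logMahlerMeasure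
    (mul_ne_zero (map_intCastRingHom_ne_zero h₁) (map_intCastRingHom_ne_zero h₂))

/-- Monotonicity along divisibility: `Q ∣ P`, `P ≠ 0` ⇒ `log M(Q) ≤ log M(P)`. [folklore] -/
lemma logMahlerMeasure_map_le_of_dvd {Q P : ℤ[X]} (hP : P ≠ 0) (h : Q ∣ P) :
    (Q.map (Int.castRingHom ℂ)).logMahlerMeasure ≤
      (P.map (Int.castRingHom ℂ)).logMahlerMeasure := by
  obtain ⟨R, rfl⟩ := h
  have hQ : Q ≠ 0 := left_ne_zero_of_mul hP
  have hR : R ≠ 0 := right_ne_zero_of_mul hP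
  rw [logMahlerMeasure_map_mul hQ hR]
  linarith [logMahlerMeasure_map_nonneg hR]

/-- `log M(P) ≤ ½ log(deg P + 1) + log H(P) ≤ deg P + log H(P)` (Landau's inequality
`M(P) ≤ ‖P‖₂ ≤ √(d+1) H(P)`, Mathlib `mahlerMeasure_le_sqrt_natDegree_add_one_mul_supNorm`).
[folklore] -/
lemma logMahlerMeasure_map_le {P : ℤ[X]} (hP : P ≠ 0) :
    (P.map (Int.castRingHom ℂ)).logMahlerMeasure ≤ P.natDegree + Real.log P.supNorm := by
  have hM := (P.map (Int.castRingHom ℂ)).mahlerMeasure_le_sqrt_natDegree_add_one_mul_supNorm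
  rw [natDegree_map_intCastRingHom, supNorm_map_intCastRingHom] at hM
  have hH : 1 ≤ P.supNorm := one_le_supNorm_of_ne_zero hP
  have hpos : 0 < (P.map (Int.castRingHom ℂ)).mahlerMeasure :=
    lt_of_lt_of_le one_pos (Polynomial.one_le_mahlerMeasure_of_ne_zero hP)
  rw [logMahlerMeasure_eq_log_MahlerMeasure]
  calc Real.log (P.map (Int.castRingHom ℂ)).mahlerMeasure
      ≤ Real.log (√(P.natDegree + 1) * P.supNorm) := Real.log_le_log hpos hM
    _ = Real.log √(P.natDegree + 1) + Real.log P.supNorm :=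
        Real.log_mul (by positivity) (by positivity)
    _ ≤ P.natDegree + Real.log P.supNorm := by
        gcongr
        calc Real.log √(P.natDegree + 1) ≤ √(P.natDegree + 1) - 1 :=
              Real.log_le_sub_one_of_pos (by positivity)
          _ ≤ (P.natDegree + 1) - 1 := by
              gcongr
              rw [Real.sqrt_le_left (by positivity)]
              nlinarith
          _ = P.natDegree := by ring

/-- `log H(Q) ≤ deg Q · log 2 + log M(Q) ≤ deg Q + log M(Q)` (Mahler's coefficient bound
`|a_i| ≤ C(d, i) M(Q)`, Mathlib `supNorm_le_choose_natDegree_div_two_mul_mahlerMeasure`).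
[folklore] -/
lemma log_supNorm_le {Q : ℤ[X]} (hQ : Q ≠ 0) :
    Real.log Q.supNorm ≤ Q.natDegree + (Q.map (Int.castRingHom ℂ)).logMahlerMeasure := by
  have h := (Q.map (Int.castRingHom ℂ)).supNorm_le_choose_natDegree_div_two_mul_mahlerMeasure
  rw [natDegree_map_intCastRingHom, supNorm_map_intCastRingHom] at h
  have hH : 1 ≤ Q.supNorm := one_le_supNorm_of_ne_zero hQ
  have hM : 1 ≤ (Q.map (Int.castRingHom ℂ)).mahlerMeasure := Polynomial.one_le_mahlerMeasure_of_ne_zero hQ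
  have hch : (Q.natDegree.choose (Q.natDegree / 2) : ℝ) ≤ 2 ^ Q.natDegree := by
    exact_mod_cast Nat.choose_le_two_pow _ _
  have hchpos : (0 : ℝ) < Q.natDegree.choose (Q.natDegree / 2) := by
    exact_mod_cast Nat.choose_pos (Nat.div_le_self _ _)
  rw [logMahlerMeasure_eq_log_MahlerMeasure]
  calc Real.log Q.supNorm
      ≤ Real.log ((Q.natDegree.choose (Q.natDegree / 2)) *
          (Q.map (Int.castRingHom ℂ)).mahlerMeasure) :=
        Real.log_le_log (by linarith) h
    _ = Real.log (Q.natDegree.choose (Q.natDegree / 2)) +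
          Real.log (Q.map (Int.castRingHom ℂ)).mahlerMeasure :=
        Real.log_mul hchpos.ne' (by linarith)
    _ ≤ Real.log (2 ^ Q.natDegree) + Real.log (Q.map (Int.castRingHom ℂ)).mahlerMeasure := by
        gcongr
    _ ≤ Q.natDegree + Real.log (Q.map (Int.castRingHom ℂ)).mahlerMeasure := by
        gcongr
        rw [Real.log_pow]
        have hlog2 : Real.log 2 ≤ 1 := by
          have := Real.log_le_sub_one_of_pos (zero_lt_two (α := ℝ))
          linarith
        calc (Q.natDegree : ℝ) * Real.log 2 ≤ Q.natDegree * 1 := by gcongr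
          _ = Q.natDegree := mul_one _

/-! ### The resultant inequality (Liouville's inequality for two coprime polynomials) -/

section Resultant

/-- Reindexing the band `j₁ ≤ i ≤ j₁ + k` of a Sylvester column. [folklore] -/
lemma sum_range_ite_mem_Icc {M : Type*} [AddCommMonoid M] (N j₁ k : ℕ) (hj : j₁ + k < N)
    (F : ℕ → ℕ → M) :
    ∑ i ∈ Finset.range N, (if i ∈ Set.Icc j₁ (j₁ + k) then F i (i - j₁) else 0) =
      ∑ t ∈ Finset.range (k + 1), F (t + j₁) t := by
  rw [← Finset.sum_filter]
  have hset : (Finset.range N).filter (fun i => i ∈ Set.Icc j₁ (j₁ + k)) =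
      (Finset.range (k + 1)).image (fun t => t + j₁) := by
    ext i
    simp only [Finset.mem_filter, Finset.mem_range, Set.mem_Icc, Finset.mem_image]
    constructor
    · rintro ⟨hi, h1, h2⟩
      exact ⟨i - j₁, by omega, by omega⟩
    · rintro ⟨t, ht, rfl⟩
      exact ⟨by omega, by omega, by omega⟩
  rw [hset, Finset.sum_image (fun a _ b _ h => by simpa using h)]
  refine Finset.sum_congr rfl fun t _ => ?_
  rw [Nat.add_sub_cancel]

/-- The row vector `(1, θ, θ², …)` times a Sylvester column of `h` (band starting at `j₁`) is
`θ^{j₁} h(θ)`. [folklore] -/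
lemma sum_pow_mul_sylvester_col (h : ℂ[X]) (θ : ℂ) (N j₁ k : ℕ) (hk : h.natDegree ≤ k)
    (hj : j₁ + k < N) :
    ∑ i ∈ Finset.range N, θ ^ i * (if i ∈ Set.Icc j₁ (j₁ + k) then h.coeff (i - j₁) else 0) =
      θ ^ j₁ * h.eval θ := by
  have : ∀ i, θ ^ i * (if i ∈ Set.Icc j₁ (j₁ + k) then h.coeff (i - j₁) else 0) =
      if i ∈ Set.Icc j₁ (j₁ + k) then θ ^ i * h.coeff (i - j₁) else 0 := fun i => by
    split_ifs <;> simp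
  simp_rw [this]
  rw [sum_range_ite_mem_Icc N j₁ k hj (fun i t => θ ^ i * h.coeff t),
    eval_eq_sum_range' (n := k + 1) (Nat.lt_succ_of_le hk), Finset.mul_sum]
  refine Finset.sum_congr rfl fun t _ => ?_
  rw [pow_add]
  ring

/-- Column sums of a Sylvester column of `h`: `∑_i |entry| ≤ ‖h‖₁`. [folklore] -/
lemma sum_norm_sylvester_col_le (h : ℤ[X]) (N j₁ k : ℕ) (hk : h.natDegree ≤ k) (hj : j₁ + k < N) :
    ∑ i ∈ Finset.range N, ‖(if i ∈ Set.Icc j₁ (j₁ + k) then (h.map (Int.castRingHom ℂ)).coeff (i - j₁) else 0)‖ ≤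
      h.l1norm := by
  have : ∀ i, ‖(if i ∈ Set.Icc j₁ (j₁ + k) then (h.map (Int.castRingHom ℂ)).coeff (i - j₁) else 0)‖ =
      if i ∈ Set.Icc j₁ (j₁ + k) then ‖(h.map (Int.castRingHom ℂ)).coeff (i - j₁)‖ else 0 := fun i => by
    split_ifs <;> simp
  simp_rw [this]
  rw [sum_range_ite_mem_Icc N j₁ k hj (fun _ t => ‖(h.map (Int.castRingHom ℂ)).coeff t‖)]
  unfold l1norm
  have hsub : h.support ⊆ Finset.range (k + 1) :=
    supp_subset_range_natDegree_succ.trans (Finset.range_mono (Nat.succ_le_succ hk))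
  refine le_of_eq ?_
  calc ∑ t ∈ Finset.range (k + 1), ‖(h.map (Int.castRingHom ℂ)).coeff t‖
      = ∑ t ∈ Finset.range (k + 1), ‖h.coeff t‖ := by
        refine Finset.sum_congr rfl fun t _ => ?_
        simp [Int.norm_eq_abs]
    _ = ∑ t ∈ h.support, ‖h.coeff t‖ :=
        (Finset.sum_subset hsub fun i _ hi => by simp [notMem_support_iff.mp hi]).symm

/-- **Liouville's inequality for the resultant.** If `f, g ∈ ℤ[X]` are coprime over `ℚ`, of
degrees `m, n` with `m + n > 0`, then for every `θ ∈ ℂ`,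
`1 ≤ (m+n) · max(1,|θ|)^{m+n} · (1+‖g‖₁)^m (1+‖f‖₁)^n · max(|f(θ)|, |g(θ)|)`: the resultant is a
nonzero integer, and equals `∑_j w_j c_j` with `w = (1, θ, θ², …) · Syl(f, g) =
(g(θ), θg(θ), …, θ^{m-1}g(θ), f(θ), …, θ^{n-1}f(θ))` and cofactors `c_j` bounded by the column
sums (the classical resultant argument of Gelfond's method). [folklore] -/
theorem resultant_liouville (f g : ℤ[X]) (θ : ℂ) (hmn : 0 < f.natDegree + g.natDegree)
    (hcop : IsCoprime (f.map (Int.castRingHom ℚ)) (g.map (Int.castRingHom ℚ))) :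
    1 ≤ (f.natDegree + g.natDegree) * max 1 ‖θ‖ ^ (f.natDegree + g.natDegree) *
      ((1 + g.l1norm) ^ f.natDegree * (1 + f.l1norm) ^ g.natDegree) *
        max ‖aeval θ f‖ ‖aeval θ g‖ := by
  set m := f.natDegree with hm
  set n := g.natDegree with hn
  set R : ℤ := resultant f g m n with hR
  -- the resultant is a nonzero integer
  have hR0 : R ≠ 0 := by
    intro h0
    have hq : resultant (f.map (Int.castRingHom ℚ)) (g.map (Int.castRingHom ℚ)) m n = 0 := by
      rw [resultant_map_map, ← hR, h0, map_zero]
    have hm' : (f.map (Int.castRingHom ℚ)).natDegree = m :=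
      natDegree_map_eq_of_injective (RingHom.injective_int _) _
    have hn' : (g.map (Int.castRingHom ℚ)).natDegree = n :=
      natDegree_map_eq_of_injective (RingHom.injective_int _) _
    have := (resultant_eq_zero_iff (f := f.map (Int.castRingHom ℚ))
      (g := g.map (Int.castRingHom ℚ))).mp (by rw [hm', hn']; exact hq)
    exact this.2 hcop
  have hR1 : (1 : ℝ) ≤ ‖(R : ℂ)‖ := by
    rw [Complex.norm_intCast, ← Int.cast_abs]
    exact_mod_cast Int.one_le_abs hR0
  -- the complex Sylvester matrix and its determinant
  set S : Matrix (Fin (m + n)) (Fin (m + n)) ℂ := sylvester (f.map (Int.castRingHom ℂ)) (g.map (Int.castRingHom ℂ)) m n with hS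
  have hdet : S.det = (R : ℂ) := by
    have h := resultant_map_map f g m n (Int.castRingHom ℂ)
    rw [eq_intCast] at h
    exact h
  -- the row vector `v = (θ^i)` and `w = v S`
  set v : Fin (m + n) → ℂ := fun i => θ ^ (i : ℕ) with hv
  set μ : ℝ := max 1 ‖θ‖ with hμ
  have hμ1 : 1 ≤ μ := le_max_left _ _
  set E : ℝ := max ‖aeval θ f‖ ‖aeval θ g‖ with hE
  have hw : ∀ j, ‖(v ᵥ* S) j‖ ≤ μ ^ (m + n) * E := by
    intro j
    rw [Matrix.vecMul, dotProduct]
    refine Fin.addCases (fun j₁ => ?_) (fun j₁ => ?_) j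
    · -- a `g`-column
      have hcol : ∀ i : Fin (m + n), S i (Fin.castAdd n j₁) =
          if (i : ℕ) ∈ Set.Icc (j₁ : ℕ) (j₁ + n) then (g.map (Int.castRingHom ℂ)).coeff (i - j₁) else 0 := fun i => by
        rw [hS, sylvester, Matrix.of_apply, Fin.addCases_left]
      simp_rw [hcol, hv]
      rw [Fin.sum_univ_eq_sum_range (fun i => θ ^ i *
          (if i ∈ Set.Icc (j₁ : ℕ) (j₁ + n) then (g.map (Int.castRingHom ℂ)).coeff (i - j₁) else 0)) (m + n),
        sum_pow_mul_sylvester_col (g.map (Int.castRingHom ℂ)) θ (m + n) j₁ n (by simp [hn, natDegree_map_intCastRingHom]) (by omega),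
        norm_mul, norm_pow, eval_map_intCastRingHom]
      calc ‖θ‖ ^ (j₁ : ℕ) * ‖aeval θ g‖ ≤ μ ^ (j₁ : ℕ) * E := by
            gcongr
            · exact le_max_right _ _
            · exact le_max_right _ _
        _ ≤ μ ^ (m + n) * E := by
            gcongr
            · lia
    · -- an `f`-column
      have hcol : ∀ i : Fin (m + n), S i (Fin.natAdd m j₁) =
          if (i : ℕ) ∈ Set.Icc (j₁ : ℕ) (j₁ + m) then (f.map (Int.castRingHom ℂ)).coeff (i - j₁) else 0 := fun i => by
        rw [hS, sylvester, Matrix.of_apply, Fin.addCases_right]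
      simp_rw [hcol, hv]
      rw [Fin.sum_univ_eq_sum_range (fun i => θ ^ i *
          (if i ∈ Set.Icc (j₁ : ℕ) (j₁ + m) then (f.map (Int.castRingHom ℂ)).coeff (i - j₁) else 0)) (m + n),
        sum_pow_mul_sylvester_col (f.map (Int.castRingHom ℂ)) θ (m + n) j₁ m (by simp [hm, natDegree_map_intCastRingHom]) (by omega),
        norm_mul, norm_pow, eval_map_intCastRingHom]
      calc ‖θ‖ ^ (j₁ : ℕ) * ‖aeval θ f‖ ≤ μ ^ (j₁ : ℕ) * E := by
            gcongr
            · exact le_max_right _ _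
            · exact le_max_left _ _
        _ ≤ μ ^ (m + n) * E := by
            gcongr
            · lia
  -- cofactor bound
  set B : ℝ := (1 + g.l1norm) ^ m * (1 + f.l1norm) ^ n with hB
  have hcolsum : ∀ j, ∑ i, ‖S i j‖ ≤
      Fin.addCases (fun _ : Fin m => g.l1norm) (fun _ : Fin n => f.l1norm) j := by
    intro j
    refine Fin.addCases (fun j₁ => ?_) (fun j₁ => ?_) j
    · rw [Fin.addCases_left]
      have hcol : ∀ i : Fin (m + n), S i (Fin.castAdd n j₁) =
          if (i : ℕ) ∈ Set.Icc (j₁ : ℕ) (j₁ + n) then (g.map (Int.castRingHom ℂ)).coeff (i - j₁) else 0 := fun i => by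
        rw [hS, sylvester, Matrix.of_apply, Fin.addCases_left]
      simp_rw [hcol]
      rw [Fin.sum_univ_eq_sum_range (fun i =>
          ‖(if i ∈ Set.Icc (j₁ : ℕ) (j₁ + n) then (g.map (Int.castRingHom ℂ)).coeff (i - j₁) else 0)‖) (m + n)]
      exact sum_norm_sylvester_col_le g (m + n) j₁ n hn.ge (by omega)
    · rw [Fin.addCases_right]
      have hcol : ∀ i : Fin (m + n), S i (Fin.natAdd m j₁) =
          if (i : ℕ) ∈ Set.Icc (j₁ : ℕ) (j₁ + m) then (f.map (Int.castRingHom ℂ)).coeff (i - j₁) else 0 := fun i => by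
        rw [hS, sylvester, Matrix.of_apply, Fin.addCases_right]
      simp_rw [hcol]
      rw [Fin.sum_univ_eq_sum_range (fun i =>
          ‖(if i ∈ Set.Icc (j₁ : ℕ) (j₁ + m) then (f.map (Int.castRingHom ℂ)).coeff (i - j₁) else 0)‖) (m + n)]
      exact sum_norm_sylvester_col_le f (m + n) j₁ m hm.ge (by omega)
  have hadj : ∀ i j, ‖S.adjugate i j‖ ≤ B := by
    intro i j
    rw [Matrix.adjugate_apply]
    refine (Matrix.norm_det_updateRow_single_le S j i _ hcolsum).trans (le_of_eq ?_)
    rw [Fin.prod_univ_add]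
    simp [hB]
  -- `det S · v = w · adj S`, read off at the index `0`
  set i0 : Fin (m + n) := ⟨0, hmn⟩ with hi0
  have hkey : (S.det • v) i0 = ((v ᵥ* S) ᵥ* S.adjugate) i0 := by
    rw [Matrix.vecMul_vecMul, Matrix.mul_adjugate, Matrix.vecMul_smul, Matrix.vecMul_one]
  have hv0 : v i0 = 1 := by simp [hv, hi0]
  rw [Pi.smul_apply, hv0, smul_eq_mul, mul_one, Matrix.vecMul, dotProduct] at hkey
  -- estimate
  have hE0 : 0 ≤ E := le_trans (norm_nonneg _) (le_max_left _ _)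
  have hB0 : 0 ≤ B := by
    have := g.l1norm_nonneg; have := f.l1norm_nonneg; positivity
  calc (1 : ℝ) ≤ ‖(R : ℂ)‖ := hR1
    _ = ‖∑ j, (v ᵥ* S) j * S.adjugate j i0‖ := by rw [← hdet, hkey]
    _ ≤ ∑ j, ‖(v ᵥ* S) j * S.adjugate j i0‖ := norm_sum_le _ _
    _ ≤ ∑ _j : Fin (m + n), μ ^ (m + n) * E * B := by
        refine Finset.sum_le_sum fun j _ => ?_
        rw [norm_mul]
        exact mul_le_mul (hw j) (hadj j i0) (norm_nonneg _) (by positivity)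
    _ = (m + n : ℕ) * (μ ^ (m + n) * E * B) := by simp
    _ = (m + n) * μ ^ (m + n) * B * E := by push_cast; ring

end Resultant

end Polynomial


namespace Polynomial

/-! ### Gelfond's weight and the extraction of a small irreducible factor -/

/-- The additive weight `w_{δ,σ}(Q) = δ (deg Q + log M(Q)) + σ deg Q` used to select an
irreducible factor (a Mahler-measure variant of the size `δ log H + σ deg`; additive because
`deg` and `log M` are); `log M(Q)` is Mathlib's `logMahlerMeasure` of `Q.map (Int.castRingHom ℂ)`.
[folklore] -/
def gelfondWeight (δ σ : ℝ) (Q : ℤ[X]) : ℝ :=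
  δ * (Q.natDegree + (Q.map (Int.castRingHom ℂ)).logMahlerMeasure) + σ * Q.natDegree

/-- Additivity of the weight: `w(Q₁Q₂) = w(Q₁) + w(Q₂)`. [folklore] -/
lemma gelfondWeight_mul {δ σ : ℝ} {Q₁ Q₂ : ℤ[X]} (h₁ : Q₁ ≠ 0) (h₂ : Q₂ ≠ 0) :
    gelfondWeight δ σ (Q₁ * Q₂) = gelfondWeight δ σ Q₁ + gelfondWeight δ σ Q₂ := by
  unfold gelfondWeight
  rw [natDegree_mul h₁ h₂, logMahlerMeasure_map_mul h₁ h₂]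
  push_cast
  ring

/-- `w(Q) ≥ 0` for `Q ≠ 0` and `δ, σ ≥ 0`. [folklore] -/
lemma gelfondWeight_nonneg {δ σ : ℝ} (hδ : 0 ≤ δ) (hσ : 0 ≤ σ) {Q : ℤ[X]} (hQ : Q ≠ 0) :
    0 ≤ gelfondWeight δ σ Q := by
  unfold gelfondWeight
  have := logMahlerMeasure_map_nonneg hQ
  positivity

/-- `δ log H(Q) + σ deg Q ≤ w_{δ,σ}(Q)`. [folklore] -/
lemma le_gelfondWeight {δ σ : ℝ} (hδ : 0 ≤ δ) {Q : ℤ[X]} (hQ : Q ≠ 0) :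
    δ * Real.log Q.supNorm + σ * Q.natDegree ≤ gelfondWeight δ σ Q := by
  unfold gelfondWeight
  have := log_supNorm_le hQ
  nlinarith

/-- `w_{δ,σ}(P) ≤ δ (2 deg P + log H(P)) + σ deg P`. [folklore] -/
lemma gelfondWeight_le {δ σ : ℝ} (hδ : 0 ≤ δ) {P : ℤ[X]} (hP : P ≠ 0) :
    gelfondWeight δ σ P ≤ δ * (2 * P.natDegree + Real.log P.supNorm) + σ * P.natDegree := by
  unfold gelfondWeight
  have := logMahlerMeasure_map_le hP
  nlinarith

/-- The value of a unit of `ℤ[X]` (i.e. `±1`) at any complex number has norm `1`. [folklore] -/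
lemma norm_aeval_of_isUnit {u : ℤ[X]} (hu : IsUnit u) (θ : ℂ) : ‖aeval θ u‖ = 1 := by
  obtain ⟨r, hr, rfl⟩ := Polynomial.isUnit_iff.mp hu
  rw [aeval_C, algebraMap_int_eq, eq_intCast, Complex.norm_intCast]
  rcases Int.isUnit_iff.mp hr with h | h <;> simp [h]

/-- Associated integer polynomials have values of the same norm. [folklore] -/
lemma norm_aeval_eq_of_associated {p q : ℤ[X]} (h : Associated p q) (θ : ℂ) :
    ‖aeval θ p‖ = ‖aeval θ q‖ := by
  obtain ⟨u, rfl⟩ := h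
  rw [map_mul, norm_mul, norm_aeval_of_isUnit u.isUnit, mul_one]

/-- A nonzero constant integer polynomial has value of norm `≥ 1` everywhere. [folklore] -/
lemma one_le_norm_aeval_of_natDegree_eq_zero {p : ℤ[X]} (hp : p ≠ 0) (hd : p.natDegree = 0)
    (θ : ℂ) : 1 ≤ ‖aeval θ p‖ := by
  have hc : p.coeff 0 ≠ 0 := by
    intro hc
    apply hp
    rw [eq_C_of_natDegree_eq_zero hd, hc, C_0]
  rw [eq_C_of_natDegree_eq_zero hd, aeval_C, algebraMap_int_eq, eq_intCast, Complex.norm_intCast,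
    ← Int.cast_abs]
  exact_mod_cast Int.one_le_abs hc

/-- **Extraction step.** If a nonconstant `P ∈ ℤ[X]` satisfies `|P(θ)| < e^{-ρ w(P)}` for the
additive weight `w = w_{δ,σ}`, then some irreducible nonconstant factor `Q ∣ P` satisfies
`|Q(θ)| < e^{-ρ w(Q)}` (Gelfond; the additive-weight form is Brownawell's and Waldschmidt's).
[folklore] -/
theorem exists_irreducible_dvd_small (θ : ℂ) {δ σ ρ : ℝ} (hδ : 0 ≤ δ) (hσ : 0 ≤ σ) (hρ : 0 ≤ ρ)
    (P : ℤ[X]) (hP0 : P ≠ 0) (hPd : 0 < P.natDegree)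
    (hP : ‖aeval θ P‖ < Real.exp (-ρ * gelfondWeight δ σ P)) :
    ∃ Q : ℤ[X], Irreducible Q ∧ 0 < Q.natDegree ∧ Q ∣ P ∧
      ‖aeval θ Q‖ < Real.exp (-ρ * gelfondWeight δ σ Q) := by
  induction P using WfDvdMonoid.induction_on_irreducible with
  | zero => exact absurd rfl hP0
  | unit u hu =>
    rw [natDegree_eq_zero_of_isUnit hu] at hPd
    exact absurd hPd (lt_irrefl 0)
  | mul Q' p hQ' hp ih =>
    have hp0 : p ≠ 0 := hp.ne_zero
    have hw : gelfondWeight δ σ (p * Q') = gelfondWeight δ σ p + gelfondWeight δ σ Q' :=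
      gelfondWeight_mul hp0 hQ'
    have hwp : 0 ≤ gelfondWeight δ σ p := gelfondWeight_nonneg hδ hσ hp0
    have hwQ : 0 ≤ gelfondWeight δ σ Q' := gelfondWeight_nonneg hδ hσ hQ'
    have heval : aeval θ (p * Q') = aeval θ p * aeval θ Q' := map_mul _ _ _
    rw [heval, norm_mul, hw] at hP
    by_cases hpd : p.natDegree = 0
    · -- `p` is a (prime) constant: pass to `Q'`
      have h1 : 1 ≤ ‖aeval θ p‖ := one_le_norm_aeval_of_natDegree_eq_zero hp0 hpd θ
      have hQd : 0 < Q'.natDegree := by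
        rw [natDegree_mul hp0 hQ', hpd, zero_add] at hPd
        exact hPd
      have hQs : ‖aeval θ Q'‖ < Real.exp (-ρ * gelfondWeight δ σ Q') := by
        have h2 : ‖aeval θ Q'‖ ≤ ‖aeval θ p‖ * ‖aeval θ Q'‖ := by
          calc ‖aeval θ Q'‖ = 1 * ‖aeval θ Q'‖ := (one_mul _).symm
            _ ≤ ‖aeval θ p‖ * ‖aeval θ Q'‖ := by gcongr
        refine (h2.trans_lt hP).trans_le (Real.exp_le_exp.mpr ?_)
        nlinarith
      obtain ⟨Q, hQ, hQd', hQdvd, hQs'⟩ := ih hQ' hQd hQs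
      exact ⟨Q, hQ, hQd', hQdvd.trans (dvd_mul_left Q' p), hQs'⟩
    · by_cases hps : ‖aeval θ p‖ < Real.exp (-ρ * gelfondWeight δ σ p)
      · exact ⟨p, hp, Nat.pos_of_ne_zero hpd, dvd_mul_right p Q', hps⟩
      · push Not at hps
        have hppos : 0 < ‖aeval θ p‖ := lt_of_lt_of_le (Real.exp_pos _) hps
        by_cases hQd : Q'.natDegree = 0
        · exfalso
          have h1 : 1 ≤ ‖aeval θ Q'‖ := one_le_norm_aeval_of_natDegree_eq_zero hQ' hQd θ
          have h2 : ‖aeval θ p‖ ≤ ‖aeval θ p‖ * ‖aeval θ Q'‖ := by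
            calc ‖aeval θ p‖ = ‖aeval θ p‖ * 1 := (mul_one _).symm
              _ ≤ ‖aeval θ p‖ * ‖aeval θ Q'‖ := by gcongr
          have h3 : Real.exp (-ρ * (gelfondWeight δ σ p + gelfondWeight δ σ Q')) ≤
              Real.exp (-ρ * gelfondWeight δ σ p) := Real.exp_le_exp.mpr (by nlinarith)
          linarith
        · have hQs : ‖aeval θ Q'‖ < Real.exp (-ρ * gelfondWeight δ σ Q') := by
            have h3 : ‖aeval θ p‖ * ‖aeval θ Q'‖ <
                ‖aeval θ p‖ * Real.exp (-ρ * gelfondWeight δ σ Q') := by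
              calc ‖aeval θ p‖ * ‖aeval θ Q'‖
                  < Real.exp (-ρ * (gelfondWeight δ σ p + gelfondWeight δ σ Q')) := hP
                _ = Real.exp (-ρ * gelfondWeight δ σ p) * Real.exp (-ρ * gelfondWeight δ σ Q') := by
                    rw [← Real.exp_add]; ring_nf
                _ ≤ ‖aeval θ p‖ * Real.exp (-ρ * gelfondWeight δ σ Q') := by gcongr
            exact lt_of_mul_lt_mul_left h3 hppos.le
          obtain ⟨Q, hQ, hQd', hQdvd, hQs'⟩ := ih hQ' (Nat.pos_of_ne_zero hQd) hQs
          exact ⟨Q, hQ, hQd', hQdvd.trans (dvd_mul_left Q' p), hQs'⟩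

/-! ### The comparison step -/

/-- `1 + ‖Q‖₁ ≤ exp(deg Q + 1 + log H(Q))` for `Q ≠ 0`. [folklore] -/
lemma one_add_l1norm_le_exp {Q : ℤ[X]} (hQ : Q ≠ 0) :
    1 + Q.l1norm ≤ Real.exp (Q.natDegree + 1 + Real.log Q.supNorm) := by
  have hH : 1 ≤ Q.supNorm := one_le_supNorm_of_ne_zero hQ
  have h1 := l1norm_le Q
  rw [Real.exp_add, Real.exp_log (by linarith)]
  have h2 : (Q.natDegree : ℝ) + 2 ≤ Real.exp (Q.natDegree + 1) := by
    have := Real.add_one_le_exp ((Q.natDegree : ℝ) + 1); linarith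
  calc 1 + Q.l1norm ≤ 1 + (Q.natDegree + 1) * Q.supNorm := by linarith
    _ ≤ (Q.natDegree + 2) * Q.supNorm := by nlinarith
    _ ≤ Real.exp (Q.natDegree + 1) * Q.supNorm := by gcongr

/-- **Comparison step of Gelfond's criterion.** Two irreducible integer polynomials which are both
very small at `θ` relative to their weights (with parameters `(δ, σ)` and `(δ', σ')` one step
apart: `δ ≤ δ' ≤ aδ`, `σ ≤ σ' ≤ aσ`, `δ ≤ σ`, `1 ≤ σ`) cannot be coprime over `ℚ`: otherwise the
resultant inequality `resultant_liouville` is violated. The constant: `ρ ≥ 13a` suffices.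
[folklore] -/
theorem not_isCoprime_of_small {θ : ℂ} {a δ δ' σ σ' ρ : ℝ} {Q₁ Q₂ : ℤ[X]}
    (ha : 1 < a) (hδ : 0 < δ) (hσ1 : 1 ≤ σ) (hδσ : δ ≤ σ)
    (hδ' : δ ≤ δ') (hσ' : σ ≤ σ') (hδ'a : δ' ≤ a * δ) (hσ'a : σ' ≤ a * σ)
    (h₁ : Q₁ ≠ 0) (h₂ : Q₂ ≠ 0) (hd₁ : 0 < Q₁.natDegree) (hd₂ : 0 < Q₂.natDegree)
    (hd₁δ : (Q₁.natDegree : ℝ) < δ) (hd₂δ : (Q₂.natDegree : ℝ) < δ')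
    (hH₁ : Real.log Q₁.supNorm ≤ 2 * σ) (hH₂ : Real.log Q₂.supNorm ≤ 2 * σ')
    (hρ : 13 * a ≤ ρ)
    (hs₁ : ‖aeval θ Q₁‖ < Real.exp (-ρ * gelfondWeight δ σ Q₁))
    (hs₂ : ‖aeval θ Q₂‖ < Real.exp (-ρ * gelfondWeight δ' σ' Q₂)) :
    ¬ IsCoprime (Q₁.map (Int.castRingHom ℚ)) (Q₂.map (Int.castRingHom ℚ)) := by
  intro hcop
  have hL := resultant_liouville Q₁ Q₂ θ (by omega) hcop
  -- abbreviations
  set d₁ : ℕ := Q₁.natDegree with hd₁def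
  set d₂ : ℕ := Q₂.natDegree with hd₂def
  set η₁ : ℝ := Real.log Q₁.supNorm with hη₁
  set η₂ : ℝ := Real.log Q₂.supNorm with hη₂
  set w₁ : ℝ := gelfondWeight δ σ Q₁ with hw₁def
  set w₂ : ℝ := gelfondWeight δ' σ' Q₂ with hw₂def
  set μ : ℝ := max 1 ‖θ‖ with hμ
  set m : ℝ := Real.log μ with hm
  have ha0 : 0 < a := by linarith
  have hρ0 : 0 ≤ ρ := by linarith
  have hσ0 : 0 ≤ σ := by linarith
  have hσ'1 : 1 ≤ σ' := hσ1.trans hσ'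
  have hσ'0 : 0 ≤ σ' := by linarith
  have hδ'0 : 0 ≤ δ' := hδ.le.trans hδ'
  have hHQ₁ : 1 ≤ Q₁.supNorm := one_le_supNorm_of_ne_zero h₁
  have hHQ₂ : 1 ≤ Q₂.supNorm := one_le_supNorm_of_ne_zero h₂
  have hη₁0 : 0 ≤ η₁ := Real.log_nonneg hHQ₁
  have hη₂0 : 0 ≤ η₂ := Real.log_nonneg hHQ₂
  have hd₁1 : (1 : ℝ) ≤ d₁ := by exact_mod_cast hd₁
  have hd₂1 : (1 : ℝ) ≤ d₂ := by exact_mod_cast hd₂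
  have hd₁0 : (0 : ℝ) ≤ d₁ := by positivity
  have hd₂0 : (0 : ℝ) ≤ d₂ := by positivity
  have hμ1 : 1 ≤ μ := le_max_left _ _
  have hm0 : 0 ≤ m := Real.log_nonneg hμ1
  have hd₁δ' : (d₁ : ℝ) ≤ δ := hd₁δ.le
  have hd₂δ' : (d₂ : ℝ) ≤ a * δ := hd₂δ.le.trans hδ'a
  -- weights from below
  have hw₁ : δ * η₁ + σ * d₁ ≤ w₁ := le_gelfondWeight hδ.le h₁
  have hw₂ : δ' * η₂ + σ' * d₂ ≤ w₂ := le_gelfondWeight hδ'0 h₂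
  have p1 : σ ≤ σ * d₁ := le_mul_of_one_le_right hσ0 hd₁1
  have p2 : 0 ≤ δ * η₁ := mul_nonneg hδ.le hη₁0
  have p3 : 0 ≤ σ * d₁ := mul_nonneg hσ0 hd₁0
  have hσw₁ : σ ≤ w₁ := by linarith
  have hσd₁w₁ : σ * d₁ ≤ w₁ := by linarith
  have hδη₁w₁ : δ * η₁ ≤ w₁ := by linarith
  have hδd₁w₁ : δ * d₁ ≤ w₁ := (mul_le_mul_of_nonneg_right hδσ hd₁0).trans hσd₁w₁
  have hδw₁ : δ ≤ w₁ := hδσ.trans hσw₁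
  have p1' : σ' ≤ σ' * d₂ := le_mul_of_one_le_right hσ'0 hd₂1
  have p2' : 0 ≤ δ' * η₂ := mul_nonneg hδ'0 hη₂0
  have p3' : 0 ≤ σ' * d₂ := mul_nonneg hσ'0 hd₂0
  have hσw₂ : σ' ≤ w₂ := by linarith
  have hσd₂w₂ : σ' * d₂ ≤ w₂ := by linarith
  have hδη₂w₂ : δ' * η₂ ≤ w₂ := by linarith
  have hw₁pos : 0 < w₁ := by linarith
  have hw₂pos : 0 < w₂ := by linarith
  -- both values are `< 1`, so `|θ| < 1 + H(Q_i)` and `m ≤ 1 + η_i`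
  have hs₁1 : ‖aeval θ Q₁‖ < 1 :=
    hs₁.trans_le (Real.exp_le_one_iff.mpr (by
      have := mul_nonneg hρ0 hw₁pos.le; linarith))
  have hs₂1 : ‖aeval θ Q₂‖ < 1 :=
    hs₂.trans_le (Real.exp_le_one_iff.mpr (by
      have := mul_nonneg hρ0 hw₂pos.le; linarith))
  have hlog2 : Real.log 2 ≤ 1 := by
    have := Real.log_le_sub_one_of_pos (zero_lt_two (α := ℝ)); linarith
  have hmη : ∀ {Q : ℤ[X]}, Q ≠ 0 → ‖aeval θ Q‖ < 1 → m ≤ 1 + Real.log Q.supNorm := by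
    intro Q hQ hQ1
    have hθ := norm_lt_one_add_supNorm hQ hQ1
    have hHQ : 1 ≤ Q.supNorm := one_le_supNorm_of_ne_zero hQ
    have hμle : μ ≤ 2 * Q.supNorm := max_le (by linarith) (by linarith)
    calc m ≤ Real.log (2 * Q.supNorm) := Real.log_le_log (by positivity) hμle
      _ = Real.log 2 + Real.log Q.supNorm := Real.log_mul two_ne_zero (by positivity)
      _ ≤ 1 + Real.log Q.supNorm := by linarith
  have hm₁ : m ≤ 1 + η₁ := hmη h₁ hs₁1
  have hm₂ : m ≤ 1 + η₂ := hmη h₂ hs₂1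
  -- the bracket `B ≤ exp E`
  set E : ℝ := (d₁ + d₂) + (d₁ + d₂) * m + d₁ * (d₂ + 1 + η₂) + d₂ * (d₁ + 1 + η₁) with hE
  set B : ℝ := (d₁ + d₂ : ℝ) * μ ^ (d₁ + d₂) *
      ((1 + Q₂.l1norm) ^ d₁ * (1 + Q₁.l1norm) ^ d₂) with hB
  have hl₁ := Q₁.l1norm_nonneg
  have hl₂ := Q₂.l1norm_nonneg
  have hBE : B ≤ Real.exp E := by
    have e1 : (d₁ + d₂ : ℝ) ≤ Real.exp (d₁ + d₂) := by
      have := Real.add_one_le_exp ((d₁ : ℝ) + d₂); linarith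
    have e2 : μ ^ (d₁ + d₂) = Real.exp ((d₁ + d₂) * m) := by
      rw [hm, ← Nat.cast_add, Real.exp_nat_mul, Real.exp_log (by positivity)]
    have e3 : (1 + Q₂.l1norm) ^ d₁ ≤ Real.exp (d₁ * (d₂ + 1 + η₂)) := by
      rw [Real.exp_nat_mul]
      exact pow_le_pow_left₀ (by positivity) (one_add_l1norm_le_exp h₂) _
    have e4 : (1 + Q₁.l1norm) ^ d₂ ≤ Real.exp (d₂ * (d₁ + 1 + η₁)) := by
      rw [Real.exp_nat_mul]
      exact pow_le_pow_left₀ (by positivity) (one_add_l1norm_le_exp h₁) _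
    calc B ≤ Real.exp (d₁ + d₂) * Real.exp ((d₁ + d₂) * m) *
          (Real.exp (d₁ * (d₂ + 1 + η₂)) * Real.exp (d₂ * (d₁ + 1 + η₁))) := by
          rw [hB, e2]; gcongr
      _ = Real.exp E := by
          rw [← Real.exp_add, ← Real.exp_add, ← Real.exp_add, hE]
          ring_nf
  -- `E ≤ 13 a w₁`
  have hE₁ : E ≤ 13 * a * w₁ := by
    have t0 : (d₁ : ℝ) + d₂ ≤ (1 + a) * δ := by linarith
    have t1 : (d₁ : ℝ) + d₂ ≤ (1 + a) * w₁ := by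
      have p5 : (1 + a) * δ ≤ (1 + a) * σ := mul_le_mul_of_nonneg_left hδσ (by linarith)
      have p6 : (1 + a) * σ ≤ (1 + a) * w₁ := mul_le_mul_of_nonneg_left hσw₁ (by linarith)
      linarith
    have t2 : (d₁ + d₂ : ℝ) * m ≤ 2 * (1 + a) * w₁ := by
      have q1 : (d₁ + d₂ : ℝ) * m ≤ (d₁ + d₂) * (1 + η₁) :=
        mul_le_mul_of_nonneg_left hm₁ (by positivity)
      have q2 : (d₁ + d₂ : ℝ) * η₁ ≤ ((1 + a) * δ) * η₁ := mul_le_mul_of_nonneg_right t0 hη₁0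
      have q3 : (1 + a) * (δ * η₁) ≤ (1 + a) * w₁ :=
        mul_le_mul_of_nonneg_left hδη₁w₁ (by linarith)
      linarith
    have t3 : (d₁ : ℝ) * (d₂ + 1 + η₂) ≤ (3 * a + 1) * w₁ := by
      have r0 : a * δ ≤ a * σ := mul_le_mul_of_nonneg_left hδσ ha0.le
      have r1 : (d₂ : ℝ) + 1 + η₂ ≤ (3 * a + 1) * σ := by linarith
      have r2 : (d₁ : ℝ) * (d₂ + 1 + η₂) ≤ d₁ * ((3 * a + 1) * σ) :=
        mul_le_mul_of_nonneg_left r1 hd₁0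
      have r3 : (3 * a + 1) * (σ * d₁) ≤ (3 * a + 1) * w₁ :=
        mul_le_mul_of_nonneg_left hσd₁w₁ (by linarith)
      linarith
    have t4 : (d₂ : ℝ) * (d₁ + 1 + η₁) ≤ 3 * a * w₁ := by
      have s1 : (d₂ : ℝ) * (d₁ + 1 + η₁) ≤ (a * δ) * (d₁ + 1 + η₁) :=
        mul_le_mul_of_nonneg_right hd₂δ' (by positivity)
      have s2 : a * (δ * d₁) ≤ a * w₁ := mul_le_mul_of_nonneg_left hδd₁w₁ ha0.le
      have s3 : a * δ ≤ a * w₁ := mul_le_mul_of_nonneg_left hδw₁ ha0.le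
      have s4 : a * (δ * η₁) ≤ a * w₁ := mul_le_mul_of_nonneg_left hδη₁w₁ ha0.le
      linarith
    have s5 : w₁ ≤ a * w₁ := le_mul_of_one_le_left hw₁pos.le ha.le
    rw [hE]
    linarith
  -- `E ≤ 13 a w₂`
  have hE₂ : E ≤ 13 * a * w₂ := by
    have t0 : (d₁ : ℝ) + d₂ ≤ (1 + a) * δ := by linarith
    have t1 : (d₁ : ℝ) + d₂ ≤ (1 + a) * w₂ := by
      have u1 : (1 + a) * δ ≤ (1 + a) * σ' :=
        mul_le_mul_of_nonneg_left (hδσ.trans hσ') (by linarith)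
      have u2 : (1 + a) * σ' ≤ (1 + a) * w₂ := mul_le_mul_of_nonneg_left hσw₂ (by linarith)
      linarith
    have t2 : (d₁ + d₂ : ℝ) * m ≤ (3 + a) * w₂ := by
      have v1 : (d₁ + d₂ : ℝ) * m ≤ (d₁ + d₂) * (1 + η₂) :=
        mul_le_mul_of_nonneg_left hm₂ (by positivity)
      have v0 : (d₁ : ℝ) + d₂ ≤ 2 * δ' := by linarith [hd₂δ.le]
      have v2 : (d₁ + d₂ : ℝ) * η₂ ≤ (2 * δ') * η₂ := mul_le_mul_of_nonneg_right v0 hη₂0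
      linarith
    have t3 : (d₁ : ℝ) * (d₂ + 1 + η₂) ≤ 3 * w₂ := by
      have x1 : (d₁ : ℝ) * (d₂ + 1 + η₂) ≤ δ * (d₂ + 1 + η₂) :=
        mul_le_mul_of_nonneg_right hd₁δ' (by positivity)
      have x2 : δ * d₂ ≤ σ' * d₂ := mul_le_mul_of_nonneg_right (hδσ.trans hσ') hd₂0
      have x3 : δ * η₂ ≤ δ' * η₂ := mul_le_mul_of_nonneg_right hδ' hη₂0
      linarith
    have t4 : (d₂ : ℝ) * (d₁ + 1 + η₁) ≤ 4 * w₂ := by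
      have y0 : (d₁ : ℝ) + 1 + η₁ ≤ 4 * σ := by linarith
      have y1 : (d₂ : ℝ) * (d₁ + 1 + η₁) ≤ d₂ * (4 * σ) := mul_le_mul_of_nonneg_left y0 hd₂0
      have y2 : σ * d₂ ≤ σ' * d₂ := mul_le_mul_of_nonneg_right hσ' hd₂0
      linarith
    have z : w₂ ≤ a * w₂ := le_mul_of_one_le_left hw₂pos.le ha.le
    rw [hE]
    linarith
  -- conclusion: `B · max(|Q₁(θ)|, |Q₂(θ)|) < 1`
  have hB0 : 0 ≤ B := by positivity
  have hlt : ∀ {x w : ℝ}, 0 ≤ x → x < Real.exp (-ρ * w) → E ≤ 13 * a * w → 0 < w →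
      B * x < 1 := by
    intro x w hx hxw hEw hw
    have h0 : 13 * a * w ≤ ρ * w := mul_le_mul_of_nonneg_right hρ hw.le
    have h1 : Real.exp (-ρ * w) ≤ Real.exp (-E) := Real.exp_le_exp.mpr (by linarith)
    have hEpos : 0 < Real.exp E := Real.exp_pos E
    calc B * x ≤ Real.exp E * x := by gcongr
      _ < Real.exp E * Real.exp (-E) := by gcongr; exact hxw.trans_le h1
      _ = 1 := by rw [← Real.exp_add, add_neg_cancel, Real.exp_zero]
  have hmax : B * max ‖aeval θ Q₁‖ ‖aeval θ Q₂‖ < 1 := by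
    rw [mul_max_of_nonneg _ _ hB0]
    exact max_lt (hlt (norm_nonneg _) hs₁ hE₁ hw₁pos) (hlt (norm_nonneg _) hs₂ hE₂ hw₂pos)
  have hL' : (1 : ℝ) ≤ B * max ‖aeval θ Q₁‖ ‖aeval θ Q₂‖ := by
    simpa only [hB, Nat.cast_add] using hL
  linarith

/-- Two irreducible nonconstant integer polynomials that are not coprime over `ℚ` are associated
in `ℤ[X]` (Gauss's lemma). [folklore] -/
lemma associated_of_not_isCoprime {Q₁ Q₂ : ℤ[X]} (hQ₁ : Irreducible Q₁) (hQ₂ : Irreducible Q₂)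
    (hd₁ : 0 < Q₁.natDegree) (hd₂ : 0 < Q₂.natDegree)
    (h : ¬ IsCoprime (Q₁.map (Int.castRingHom ℚ)) (Q₂.map (Int.castRingHom ℚ))) :
    Associated Q₁ Q₂ := by
  have hp₁ : Q₁.IsPrimitive := hQ₁.isPrimitive hd₁.ne'
  have hp₂ : Q₂.IsPrimitive := hQ₂.isPrimitive hd₂.ne'
  have hi₁ : Irreducible (Q₁.map (algebraMap ℤ ℚ)) :=
    (hp₁.irreducible_iff_irreducible_map_fraction_map (K := ℚ)).mp hQ₁
  have hi₂ : Irreducible (Q₂.map (algebraMap ℤ ℚ)) :=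
    (hp₂.irreducible_iff_irreducible_map_fraction_map (K := ℚ)).mp hQ₂
  have hdvd : Q₁.map (algebraMap ℤ ℚ) ∣ Q₂.map (algebraMap ℤ ℚ) :=
    hi₁.dvd_iff_not_isCoprime.mpr (by rwa [algebraMap_int_eq])
  have hass : Associated (Q₁.map (algebraMap ℤ ℚ)) (Q₂.map (algebraMap ℤ ℚ)) :=
    hi₁.associated_of_dvd hi₂ hdvd
  exact associated_of_dvd_dvd (hp₁.dvd_of_fraction_map_dvd_fraction_map hass.dvd)
    (hp₂.dvd_of_fraction_map_dvd_fraction_map hass.symm.dvd)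

end Polynomial

/-! ### Gelfond's criterion -/

namespace Literature.NumberTheory.Transcendental

/-- Gelfond's criterion under the harmless normalisation `δ_N ≤ σ_N` (the general case reduces to
this one with `δ_N ↦ min(δ_N, σ_N)`, see `gelfond_criterion`). Constant `40`. [folklore] -/
theorem gelfond_criterion_of_le (θ : ℂ) (a : ℝ) (ha : 1 < a) (δ σ : ℕ → ℝ) (hδm : Monotone δ)
    (hσm : Monotone σ) (hδ0 : ∀ N, 0 < δ N) (hσ : Tendsto σ atTop atTop)
    (hδa : ∀ N, δ (N + 1) ≤ a * δ N) (hσa : ∀ N, σ (N + 1) < a * σ N)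
    (hδσ : ∀ N, δ N ≤ σ N) (P : ℕ → ℤ[X]) (N₀ : ℕ)
    (hP : ∀ N, N₀ ≤ N →
      P N ≠ 0 ∧ ((P N).natDegree : ℝ) < δ N ∧ (P N).gelfondType < σ N ∧
        ‖aeval θ (P N)‖ < Real.exp (-40 * a * δ N * σ N)) :
    IsAlgebraic ℚ θ ∧ ∃ N₁ : ℕ, ∀ N, N₁ ≤ N → aeval θ (P N) = 0 := by
  have ha0 : 0 < a := by linarith
  set ρ : ℝ := 40 * a / 3 with hρ
  have hρ13 : 13 * a ≤ ρ := by rw [hρ]; linarith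
  have hρ0 : 0 ≤ ρ := by positivity
  -- `σ_N ≥ 1` eventually
  obtain ⟨N₂, hN₂⟩ : ∃ N₂, ∀ N, N₂ ≤ N → 1 ≤ σ N := by
    have h := (hσ.eventually (eventually_ge_atTop 1))
    rwa [eventually_atTop] at h
  set N₁ : ℕ := max N₀ N₂ with hN₁
  -- size facts for `N ≥ N₁`
  have hfacts : ∀ N, N₁ ≤ N → P N ≠ 0 ∧ 0 < (P N).natDegree ∧ ((P N).natDegree : ℝ) < δ N ∧
      Real.log (P N).supNorm ≤ 2 * σ N ∧ 1 ≤ σ N ∧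
      ‖aeval θ (P N)‖ < Real.exp (-ρ * gelfondWeight (δ N) (σ N) (P N)) := by
    intro N hN
    obtain ⟨hP0, hPd, hPt, hPs⟩ := hP N (le_of_max_le_left hN)
    have hσ1 : 1 ≤ σ N := hN₂ N (le_of_max_le_right hN)
    have hH : 1 ≤ (P N).supNorm := one_le_supNorm_of_ne_zero hP0
    have hlogH : 0 ≤ Real.log (P N).supNorm := Real.log_nonneg hH
    unfold Polynomial.gelfondType at hPt
    refine ⟨hP0, ?_, hPd, by linarith, hσ1, ?_⟩
    · by_contra hd
      have hd0 : (P N).natDegree = 0 := by omega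
      have h1 := one_le_norm_aeval_of_natDegree_eq_zero hP0 hd0 θ
      have h2 : Real.exp (-40 * a * δ N * σ N) ≤ 1 := Real.exp_le_one_iff.mpr (by
        have := hδ0 N
        have : 0 < a * δ N * σ N := by positivity
        linarith)
      linarith
    · refine hPs.trans_le (Real.exp_le_exp.mpr ?_)
      have hw := gelfondWeight_le (hδ0 N).le hP0 (σ := σ N)
      have h3 : gelfondWeight (δ N) (σ N) (P N) ≤ 3 * (δ N * σ N) := by
        have hδ := hδ0 N
        have : (2 : ℝ) * (P N).natDegree + Real.log (P N).supNorm ≤ 2 * σ N := by linarith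
        nlinarith
      rw [hρ]; nlinarith
  -- extraction of irreducible factors
  have hex : ∀ N, N₁ ≤ N → ∃ Q : ℤ[X], Irreducible Q ∧ 0 < Q.natDegree ∧ Q ∣ P N ∧
      ‖aeval θ Q‖ < Real.exp (-ρ * gelfondWeight (δ N) (σ N) Q) := by
    intro N hN
    obtain ⟨hP0, hPd, -, -, hσ1, hPs⟩ := hfacts N hN
    exact exists_irreducible_dvd_small θ (hδ0 N).le (by linarith) hρ0 (P N) hP0 hPd hPs
  choose! Q hQ using hex
  -- consecutive factors are associated
  have hQfacts : ∀ N, N₁ ≤ N → Q N ≠ 0 ∧ ((Q N).natDegree : ℝ) < δ N ∧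
      Real.log (Q N).supNorm ≤ 2 * σ N := by
    intro N hN
    obtain ⟨hQi, hQd, hQdvd, -⟩ := hQ N hN
    obtain ⟨hP0, -, hPd, hPH, -, -⟩ := hfacts N hN
    refine ⟨hQi.ne_zero, lt_of_le_of_lt ?_ hPd, ?_⟩
    · exact_mod_cast natDegree_le_of_dvd hQdvd hP0
    · -- `log H(Q) ≤ deg Q + log M(Q) ≤ deg P + log M(P) ≤ 2 deg P + log H(P) ≤ 2σ`
      have h1 := log_supNorm_le hQi.ne_zero
      have h2 := logMahlerMeasure_map_le_of_dvd hP0 hQdvd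
      have h3 := logMahlerMeasure_map_le hP0
      have h4 : ((Q N).natDegree : ℝ) ≤ (P N).natDegree := by
        exact_mod_cast natDegree_le_of_dvd hQdvd hP0
      obtain ⟨-, -, hPt, -⟩ := hP N (le_of_max_le_left hN)
      unfold Polynomial.gelfondType at hPt
      have hlogH : 0 ≤ Real.log (P N).supNorm :=
        Real.log_nonneg (one_le_supNorm_of_ne_zero hP0)
      linarith
  have hassoc : ∀ N, N₁ ≤ N → Associated (Q N) (Q (N + 1)) := by
    intro N hN
    have hN' : N₁ ≤ N + 1 := Nat.le_succ_of_le hN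
    obtain ⟨hQi, hQd, -, hQs⟩ := hQ N hN
    obtain ⟨hQi', hQd', -, hQs'⟩ := hQ (N + 1) hN'
    obtain ⟨hQ0, hQδ, hQH⟩ := hQfacts N hN
    obtain ⟨hQ0', hQδ', hQH'⟩ := hQfacts (N + 1) hN'
    obtain ⟨-, -, -, -, hσ1, -⟩ := hfacts N hN
    refine associated_of_not_isCoprime hQi hQi' hQd hQd' ?_
    exact not_isCoprime_of_small ha (hδ0 N) hσ1 (hδσ N) (hδm N.le_succ) (hσm N.le_succ)
      (hδa N) (hσa N).le hQ0 hQ0' hQd hQd' hQδ hQδ' hQH hQH' hρ13 hQs hQs'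
  -- hence all `Q N`, `N ≥ N₁`, are associated with `Q N₁`
  have hassoc' : ∀ N, N₁ ≤ N → Associated (Q N₁) (Q N) := by
    intro N hN
    induction N, hN using Nat.le_induction with
    | base => exact Associated.refl _
    | succ N hN ih => exact ih.trans (hassoc N hN)
  -- `Q N₁ (θ) = 0`
  have hzero : aeval θ (Q N₁) = 0 := by
    have hsmall : ∀ N, N₁ ≤ N → ‖aeval θ (Q N₁)‖ ≤ Real.exp (-ρ * σ N) := by
      intro N hN
      obtain ⟨hQi, hQd, -, hQs⟩ := hQ N hN
      rw [norm_aeval_eq_of_associated (hassoc' N hN)]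
      refine hQs.le.trans (Real.exp_le_exp.mpr ?_)
      have hw := le_gelfondWeight (hδ0 N).le hQi.ne_zero (σ := σ N)
      have hd1 : (1 : ℝ) ≤ (Q N).natDegree := by exact_mod_cast hQd
      have hH : 0 ≤ Real.log (Q N).supNorm :=
        Real.log_nonneg (one_le_supNorm_of_ne_zero hQi.ne_zero)
      have hδ := hδ0 N
      obtain ⟨-, -, -, -, hσ1, -⟩ := hfacts N hN
      have p1 : σ N ≤ σ N * (Q N).natDegree := le_mul_of_one_le_right (by linarith) hd1
      have p2 : 0 ≤ δ N * Real.log (Q N).supNorm := mul_nonneg hδ.le hH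
      have hσw : σ N ≤ gelfondWeight (δ N) (σ N) (Q N) := by linarith
      have := mul_le_mul_of_nonneg_left hσw hρ0
      linarith
    have hlim : Tendsto (fun N => Real.exp (-ρ * σ N)) atTop (nhds 0) := by
      have hρpos : 0 < ρ := by rw [hρ]; positivity
      have h1 : Tendsto (fun N => -(ρ * σ N)) atTop atBot :=
        tendsto_neg_atTop_atBot.comp (hσ.const_mul_atTop hρpos)
      simp_rw [neg_mul]
      exact Real.tendsto_exp_atBot.comp h1
    have h0 : ‖aeval θ (Q N₁)‖ ≤ 0 :=
      le_of_tendsto_of_tendsto tendsto_const_nhds hlim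
        (Filter.eventually_atTop.mpr ⟨N₁, hsmall⟩)
    exact norm_le_zero_iff.mp h0
  obtain ⟨hQ0, -, -⟩ := hQfacts N₁ le_rfl
  refine ⟨⟨(Q N₁).map (algebraMap ℤ ℚ),
    (Polynomial.map_ne_zero_iff (algebraMap ℤ ℚ).injective_int).mpr hQ0,
    by rw [aeval_map_algebraMap, hzero]⟩, N₁, fun N hN => ?_⟩
  obtain ⟨-, -, hQdvd, -⟩ := hQ N hN
  obtain ⟨R, hR⟩ := hQdvd
  have hQN : aeval θ (Q N) = 0 := by
    rw [← norm_eq_zero, ← norm_aeval_eq_of_associated (hassoc' N hN), hzero, norm_zero]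
  rw [hR, map_mul, hQN, zero_mul]

/-- **Gelfond's transcendence criterion** (Chudnovsky 1984, Ch. 4, Lemma 1.1, with the constant
`6` of the printed statement replaced by `40`; Gelfond 1949, Brownawell 1974, Waldschmidt 1974).
Let `θ ∈ ℂ`, `a > 1`, and let `δ_N`, `σ_N` be monotone sequences of positive reals with
`σ_N → ∞`, `δ_{N+1} ≤ aδ_N`, `σ_{N+1} < aσ_N`. If for every `N ≥ N₀` there is a nonzero
`P_N ∈ ℤ[X]` with `deg P_N < δ_N`, `t(P_N) < σ_N` and `|P_N(θ)| < exp(-40 a δ_N σ_N)`, then `θ`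
is algebraic and `P_N(θ) = 0` for all large `N`. [cite: Chudnovsky1984, Ch. 4 Lemma 1.1 p. 177] -/
theorem gelfond_criterion (θ : ℂ) (a : ℝ) (ha : 1 < a) (δ σ : ℕ → ℝ) (hδm : Monotone δ)
    (hσm : Monotone σ) (hδ0 : ∀ N, 0 < δ N) (hσ0 : ∀ N, 0 < σ N) (hσ : Tendsto σ atTop atTop)
    (hδa : ∀ N, δ (N + 1) ≤ a * δ N) (hσa : ∀ N, σ (N + 1) < a * σ N)
    (P : ℕ → ℤ[X]) (N₀ : ℕ)
    (hP : ∀ N, N₀ ≤ N →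
      P N ≠ 0 ∧ ((P N).natDegree : ℝ) < δ N ∧ (P N).gelfondType < σ N ∧
        ‖aeval θ (P N)‖ < Real.exp (-40 * a * δ N * σ N)) :
    IsAlgebraic ℚ θ ∧ ∃ N₁ : ℕ, ∀ N, N₁ ≤ N → aeval θ (P N) = 0 := by
  have ha0 : 0 < a := by linarith
  -- replace `δ` by `min δ σ`
  set δ' : ℕ → ℝ := fun N => min (δ N) (σ N) with hδ'
  refine gelfond_criterion_of_le θ a ha δ' σ (fun M N h => min_le_min (hδm h) (hσm h)) hσm
    (fun N => lt_min (hδ0 N) (hσ0 N)) hσ (fun N => ?_) hσa (fun N => min_le_right _ _) P N₀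
    (fun N hN => ?_)
  · show min (δ (N + 1)) (σ (N + 1)) ≤ a * min (δ N) (σ N)
    rw [mul_min_of_nonneg _ _ ha0.le]
    exact min_le_min (hδa N) (hσa N).le
  · obtain ⟨hP0, hPd, hPt, hPs⟩ := hP N hN
    have hlogH : 0 ≤ Real.log (P N).supNorm := Real.log_nonneg (one_le_supNorm_of_ne_zero hP0)
    have hPd' : ((P N).natDegree : ℝ) < σ N := by
      unfold Polynomial.gelfondType at hPt; linarith
    refine ⟨hP0, lt_min hPd hPd', hPt, hPs.trans_le (Real.exp_le_exp.mpr ?_)⟩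
    show -40 * a * δ N * σ N ≤ -40 * a * min (δ N) (σ N) * σ N
    have h1 : min (δ N) (σ N) ≤ δ N := min_le_left _ _
    have h2 := hσ0 N
    have h3 : 40 * a * σ N * min (δ N) (σ N) ≤ 40 * a * σ N * δ N :=
      mul_le_mul_of_nonneg_left h1 (by positivity)
    linarith

/-- The transcendence half of `gelfond_criterion`, in the shape of
`GelfondCriterion.not_small_values` (`GelfondCriterion.lean`) with the constant `40` for `6`: a
transcendental `θ` admits no sequence of nonzero integer polynomials `P_N` with `deg P_N < δ_N`,
`t(P_N) < σ_N` that are all smaller than `exp(-40 a δ_N σ_N)` at `θ`.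
[cite: Chudnovsky1984, Ch. 4 Lemma 1.1 p. 177] -/
theorem gelfond_criterion_not_small_values {θ : ℂ} (hθ : Transcendental ℚ θ) (a : ℝ) (ha : 1 < a)
    (δ σ : ℕ → ℝ) (hδm : Monotone δ) (hσm : Monotone σ) (hδ0 : ∀ N, 0 < δ N)
    (hσ0 : ∀ N, 0 < σ N) (hσ : Tendsto σ atTop atTop) (hδa : ∀ N, δ (N + 1) ≤ a * δ N)
    (hσa : ∀ N, σ (N + 1) < a * σ N) (P : ℕ → ℤ[X]) (N₀ : ℕ)
    (hP : ∀ N, N₀ ≤ N → P N ≠ 0 ∧ ((P N).natDegree : ℝ) < δ N ∧ (P N).gelfondType < σ N) :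
    ∃ N, N₀ ≤ N ∧ Real.exp (-40 * a * δ N * σ N) ≤ ‖aeval θ (P N)‖ := by
  by_contra hcon
  push Not at hcon
  exact hθ (gelfond_criterion θ a ha δ σ hδm hσm hδ0 hσ0 hσ hδa hσa P N₀
    fun N hN => ⟨(hP N hN).1, (hP N hN).2.1, (hP N hN).2.2, hcon N hN⟩).1

end Literature.NumberTheory.Transcendental

end

/-! ## Appendix: the printed constant `6` — discharge of `GelfondCriterion`

Chudnovsky 1984, Ch. 4, Lemma 1.1 (pp. 177–178) states Gelfond's criterion with
`|P_N(θ)| < exp(-6aδ_Nσ_N)` and gives no proof (it refers to Brownawell, *Sequences of Diophantine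
approximations*, J. Number Theory 6 (1974) 11–21, and Waldschmidt, *Nombres transcendants*,
LNM 402 (1974)). The proof below is the classical extraction/comparison argument of the first
part of this file with sharper constants:

1. *Extraction with `ρ = 12a/5`.* By Landau's inequality `M(P) ≤ √(d+1) H(P)` and
   `log √(d+1) ≤ d/2`, `deg P + log M(P) ≤ (3/2) t(P) < (3/2) σ`, so
   `w_{δ,σ}(P) = δ (deg P + log M(P)) + σ deg P < (5/2) δσ` and
   `exp(-6aδσ) ≤ exp(-(12a/5) w(P))`; `exists_irreducible_dvd_small` yields an irreducible
   `Q_N ∣ P_N` with `|Q_N(θ)| < exp(-(12a/5) w(Q_N))`, `deg Q_N + log M(Q_N) ≤ (3/2) σ_N`.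
2. *Comparison.* For coprime `Q₁ = Q_N`, `Q₂ = Q_{N+1}` of degrees `d₁ < δ`, `d₂ < δ' ≤ aδ`,
   `resultant_liouville_sharp` gives `1 ≤ K (d₁ |Q₂(θ)| + d₂ |Q₁(θ)|)` with
   `log K ≤ d₂ (d₁ + log M(Q₁)) + d₁ (d₂ + log M(Q₂))` (`‖Q‖₁ ≤ 2^{deg Q} M(Q) ≤ e^{deg Q} M(Q)`),
   which is `≤ (3/2) a w(Q₁)` and `≤ (3/2) w'(Q₂)`; hence each half is
   `< aσ e^{-(9/10) aσ} ≤ 1/2` — a contradiction. No lower bound on `σ_N` and no bound on `|θ|`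
   are needed, so `N₁ = N₀` once `δ_N ≤ σ_N`.
3. The chain of associated irreducibles and the conclusion are as in `gelfond_criterion_of_le`;
   the normalisation `δ_N ↦ min(δ_N, σ_N)` is as in `gelfond_criterion`.
-/

noncomputable section

open scoped Classical

open Polynomial Filter Finset Matrix

namespace Matrix

/-- **Fine cofactor bound**: `‖adj A i j‖ ≤ ∏_{k ≠ i} ∑_{i'} ‖A i' k‖` — the cofactor omits
column `i`, so only the other column sums enter (replace column `i` of `A.updateRow j eᵢ` by
`e_j` without changing the determinant, then apply the column-sum bound). [folklore] -/
theorem norm_adjugate_le_prod_erase {n : Type*} [Fintype n] [DecidableEq n] (A : Matrix n n ℂ)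
    (i j : n) : ‖A.adjugate i j‖ ≤ ∏ k ∈ Finset.univ.erase i, ∑ i', ‖A i' k‖ := by
  rw [adjugate_apply]
  set B : Matrix n n ℂ := A.updateRow j (Pi.single i 1) with hB
  set B' : Matrix n n ℂ := B.updateCol i (Pi.single j 1) with hB'
  have hdet : B.det = B'.det := by
    have h1 : B.updateCol i (fun i' => B i' i) = B := updateCol_eq_self B i
    have h2 : (fun i' => B i' i) =
        (Pi.single j (1 : ℂ) : n → ℂ) + fun i' => B i' i - (Pi.single j (1 : ℂ) : n → ℂ) i' := by
      ext i'
      simp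
    have h3 : (B.updateCol i fun i' => B i' i - (Pi.single j (1 : ℂ) : n → ℂ) i').det = 0 := by
      refine det_eq_zero_of_row_eq_zero j fun k => ?_
      rw [updateCol_apply]
      split_ifs with hk
      · simp [hB]
      · rw [hB, updateRow_self, Pi.single_eq_of_ne hk]
    calc B.det = (B.updateCol i fun i' => B i' i).det := by rw [h1]
      _ = B'.det := by rw [h2, det_updateCol_add, h3, add_zero]
  rw [hdet]
  refine (norm_det_le_prod_sum_norm B').trans ?_
  have hcol_i : ∑ i', ‖B' i' i‖ = 1 := by
    have : ∀ i', ‖B' i' i‖ = if i' = j then 1 else 0 := fun i' => by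
      rw [hB', updateCol_self, Pi.single_apply]
      split_ifs <;> simp
    simp_rw [this, Finset.sum_ite_eq', Finset.mem_univ, if_true]
  have hcol : ∀ k, k ≠ i → ∑ i', ‖B' i' k‖ ≤ ∑ i', ‖A i' k‖ := fun k hk => by
    refine Finset.sum_le_sum fun i' _ => ?_
    rw [hB', updateCol_ne hk, hB, updateRow_apply]
    split_ifs with h
    · rw [Pi.single_eq_of_ne hk, norm_zero]
      exact norm_nonneg _
    · exact le_rfl
  calc ∏ k, ∑ i', ‖B' i' k‖
      = (∑ i', ‖B' i' i‖) * ∏ k ∈ Finset.univ.erase i, ∑ i', ‖B' i' k‖ :=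
        (Finset.mul_prod_erase _ _ (Finset.mem_univ i)).symm
    _ = ∏ k ∈ Finset.univ.erase i, ∑ i', ‖B' i' k‖ := by rw [hcol_i, one_mul]
    _ ≤ ∏ k ∈ Finset.univ.erase i, ∑ i', ‖A i' k‖ :=
        Finset.prod_le_prod (fun k _ => Finset.sum_nonneg fun _ _ => norm_nonneg _)
          fun k hk => hcol k (Finset.ne_of_mem_erase hk)

end Matrix

namespace Polynomial

/-- `‖Q‖₁ ≥ 1` for a nonzero integer polynomial. [folklore] -/
lemma one_le_l1norm_of_ne_zero {Q : ℤ[X]} (hQ : Q ≠ 0) : 1 ≤ Q.l1norm := by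
  unfold l1norm
  have hmem : Q.natDegree ∈ Q.support := natDegree_mem_support_of_nonzero hQ
  refine le_trans ?_ (Finset.single_le_sum (fun i _ => norm_nonneg (Q.coeff i)) hmem)
  rw [Int.norm_eq_abs, coeff_natDegree]
  exact_mod_cast Int.one_le_abs (leadingCoeff_ne_zero.mpr hQ)

/-- **Mahler's bound** `‖Q‖₁ ≤ 2^{deg Q} M(Q)` (sum the coefficient bounds
`|a_k| ≤ C(d, k) M(Q)`, Mathlib `norm_coeff_le_choose_mul_mahlerMeasure`). [folklore] -/
lemma l1norm_le_two_pow_mul_mahlerMeasure (Q : ℤ[X]) :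
    Q.l1norm ≤ 2 ^ Q.natDegree * (Q.map (Int.castRingHom ℂ)).mahlerMeasure := by
  have hd : (Q.map (Int.castRingHom ℂ)).natDegree = Q.natDegree := natDegree_map_intCastRingHom Q
  unfold l1norm
  calc ∑ i ∈ Q.support, ‖Q.coeff i‖
      ≤ ∑ i ∈ Finset.range (Q.natDegree + 1), ‖Q.coeff i‖ :=
        Finset.sum_le_sum_of_subset_of_nonneg supp_subset_range_natDegree_succ
          fun _ _ _ => norm_nonneg _
    _ = ∑ i ∈ Finset.range (Q.natDegree + 1), ‖(Q.map (Int.castRingHom ℂ)).coeff i‖ := by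
        refine Finset.sum_congr rfl fun i _ => ?_
        simp [Int.norm_eq_abs]
    _ ≤ ∑ i ∈ Finset.range (Q.natDegree + 1),
          (Q.natDegree.choose i : ℝ) * (Q.map (Int.castRingHom ℂ)).mahlerMeasure := by
        refine Finset.sum_le_sum fun i _ => ?_
        have h := (Q.map (Int.castRingHom ℂ)).norm_coeff_le_choose_mul_mahlerMeasure i
        rwa [hd] at h
    _ = (∑ i ∈ Finset.range (Q.natDegree + 1), (Q.natDegree.choose i : ℝ)) *
          (Q.map (Int.castRingHom ℂ)).mahlerMeasure := by rw [Finset.sum_mul]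
    _ = 2 ^ Q.natDegree * (Q.map (Int.castRingHom ℂ)).mahlerMeasure := by
        congr 1
        have h := Nat.sum_range_choose Q.natDegree
        exact_mod_cast h

/-- `‖Q‖₁ ≤ exp(deg Q + log M(Q))` for `Q ≠ 0` (from `‖Q‖₁ ≤ 2^{deg Q} M(Q)` and `2 ≤ e`).
[folklore] -/
lemma l1norm_le_exp {Q : ℤ[X]} (hQ : Q ≠ 0) :
    Q.l1norm ≤ Real.exp (Q.natDegree + (Q.map (Int.castRingHom ℂ)).logMahlerMeasure) := by
  have hM : 0 < (Q.map (Int.castRingHom ℂ)).mahlerMeasure :=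
    lt_of_lt_of_le one_pos (Polynomial.one_le_mahlerMeasure_of_ne_zero hQ)
  rw [Real.exp_add, logMahlerMeasure_eq_log_MahlerMeasure, Real.exp_log hM]
  refine (l1norm_le_two_pow_mul_mahlerMeasure Q).trans ?_
  gcongr
  rw [← mul_one (Q.natDegree : ℝ), Real.exp_nat_mul]
  exact pow_le_pow_left₀ (by norm_num) (by have := Real.add_one_le_exp (1 : ℝ); linarith) _

/-- Landau's inequality in logarithmic form: `log M(P) ≤ deg P / 2 + log H(P)`
(`M(P) ≤ √(deg P + 1) H(P)` and `log √(d+1) ≤ d/2`). [folklore] -/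
lemma logMahlerMeasure_map_le_half {P : ℤ[X]} (hP : P ≠ 0) :
    (P.map (Int.castRingHom ℂ)).logMahlerMeasure ≤ P.natDegree / 2 + Real.log P.supNorm := by
  have hM := (P.map (Int.castRingHom ℂ)).mahlerMeasure_le_sqrt_natDegree_add_one_mul_supNorm
  rw [natDegree_map_intCastRingHom, supNorm_map_intCastRingHom] at hM
  have hH : 1 ≤ P.supNorm := one_le_supNorm_of_ne_zero hP
  have hpos : 0 < (P.map (Int.castRingHom ℂ)).mahlerMeasure :=
    lt_of_lt_of_le one_pos (Polynomial.one_le_mahlerMeasure_of_ne_zero hP)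
  rw [logMahlerMeasure_eq_log_MahlerMeasure]
  calc Real.log (P.map (Int.castRingHom ℂ)).mahlerMeasure
      ≤ Real.log (√(P.natDegree + 1) * P.supNorm) := Real.log_le_log hpos hM
    _ = Real.log √(P.natDegree + 1) + Real.log P.supNorm :=
        Real.log_mul (by positivity) (by positivity)
    _ ≤ P.natDegree / 2 + Real.log P.supNorm := by
        gcongr
        rw [Real.log_sqrt (by positivity)]
        have h := Real.log_le_sub_one_of_pos (show (0 : ℝ) < P.natDegree + 1 by positivity)
        linarith

/-! ### The sharp resultant inequality -/

section Resultant

/-- **Liouville's inequality for the resultant, sharp form.** If `f, g ∈ ℤ[X]` are nonzero and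
coprime over `ℚ`, of degrees `m, n` with `m + n > 0`, then for every `θ ∈ ℂ`,
`1 ≤ ‖f‖₁^n ‖g‖₁^m (m |g(θ)| + n |f(θ)|)`: the resultant is a nonzero integer, and
`Res(f,g) θ^{i₀} = ∑_j w_j C_{i₀ j}` with `w = (1, θ, θ², …) · Syl(f, g) =
(g(θ), θg(θ), …, θ^{m-1}g(θ), f(θ), …, θ^{n-1}f(θ))`, the cofactors `C_{i₀ j}` being bounded by
the product of the `ℓ¹` norms of the other columns; one takes `i₀ = 0` if `|θ| ≤ 1` and
`i₀ = m+n-1` if `|θ| ≥ 1`, so that no power of `|θ|` survives. [folklore] -/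
theorem resultant_liouville_sharp (f g : ℤ[X]) (θ : ℂ) (hf : f ≠ 0) (hg : g ≠ 0)
    (hmn : 0 < f.natDegree + g.natDegree)
    (hcop : IsCoprime (f.map (Int.castRingHom ℚ)) (g.map (Int.castRingHom ℚ))) :
    1 ≤ f.l1norm ^ g.natDegree * g.l1norm ^ f.natDegree *
      (f.natDegree * ‖aeval θ g‖ + g.natDegree * ‖aeval θ f‖) := by
  set m := f.natDegree with hm
  set n := g.natDegree with hn
  set R : ℤ := resultant f g m n with hR
  -- the resultant is a nonzero integer
  have hR0 : R ≠ 0 := by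
    intro h0
    have hq : resultant (f.map (Int.castRingHom ℚ)) (g.map (Int.castRingHom ℚ)) m n = 0 := by
      rw [resultant_map_map, ← hR, h0, map_zero]
    have hm' : (f.map (Int.castRingHom ℚ)).natDegree = m :=
      natDegree_map_eq_of_injective (RingHom.injective_int _) _
    have hn' : (g.map (Int.castRingHom ℚ)).natDegree = n :=
      natDegree_map_eq_of_injective (RingHom.injective_int _) _
    have := (resultant_eq_zero_iff (f := f.map (Int.castRingHom ℚ))
      (g := g.map (Int.castRingHom ℚ))).mp (by rw [hm', hn']; exact hq)
    exact this.2 hcop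
  have hR1 : (1 : ℝ) ≤ ‖(R : ℂ)‖ := by
    rw [Complex.norm_intCast, ← Int.cast_abs]
    exact_mod_cast Int.one_le_abs hR0
  -- the complex Sylvester matrix and its determinant
  set S : Matrix (Fin (m + n)) (Fin (m + n)) ℂ :=
    sylvester (f.map (Int.castRingHom ℂ)) (g.map (Int.castRingHom ℂ)) m n with hS
  have hdet : S.det = (R : ℂ) := by
    have h := resultant_map_map f g m n (Int.castRingHom ℂ)
    rw [eq_intCast] at h
    exact h
  -- the row vector `v = (θ^i)` and the row index `i0` at which `det S • v = (v S) adj S` is read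
  set v : Fin (m + n) → ℂ := fun i => θ ^ (i : ℕ) with hv
  set i0 : Fin (m + n) := if ‖θ‖ ≤ 1 then ⟨0, hmn⟩ else ⟨m + n - 1, by omega⟩ with hi0
  have hvi0 : 0 < ‖v i0‖ := by
    simp only [hv, norm_pow]
    by_cases h : ‖θ‖ ≤ 1
    · rw [hi0, if_pos h]
      simp
    · rw [hi0, if_neg h]
      exact pow_pos (by linarith [not_le.mp h]) _
  have hpow : ∀ k : ℕ, k < m + n → ‖θ‖ ^ k ≤ ‖v i0‖ := by
    intro k hk
    simp only [hv, norm_pow]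
    by_cases h : ‖θ‖ ≤ 1
    · rw [hi0, if_pos h]
      simpa using pow_le_one₀ (norm_nonneg θ) h
    · rw [hi0, if_neg h]
      exact pow_le_pow_right₀ (not_le.mp h).le (show k ≤ m + n - 1 by omega)
  set E : Fin (m + n) → ℝ :=
    Fin.addCases (fun _ : Fin m => ‖aeval θ g‖) (fun _ : Fin n => ‖aeval θ f‖) with hE
  have hE0 : ∀ j, 0 ≤ E j := fun j => by
    refine Fin.addCases (fun j₁ => ?_) (fun j₁ => ?_) j
    · simp only [hE, Fin.addCases_left]; exact norm_nonneg _
    · simp only [hE, Fin.addCases_right]; exact norm_nonneg _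
  have hw : ∀ j, ‖(v ᵥ* S) j‖ ≤ ‖v i0‖ * E j := by
    intro j
    rw [Matrix.vecMul, dotProduct]
    refine Fin.addCases (fun j₁ => ?_) (fun j₁ => ?_) j
    · -- a `g`-column
      have hcol : ∀ i : Fin (m + n), S i (Fin.castAdd n j₁) =
          if (i : ℕ) ∈ Set.Icc (j₁ : ℕ) (j₁ + n) then (g.map (Int.castRingHom ℂ)).coeff (i - j₁)
          else 0 := fun i => by
        rw [hS, sylvester, Matrix.of_apply, Fin.addCases_left]
      simp_rw [hcol, hv]
      rw [Fin.sum_univ_eq_sum_range (fun i => θ ^ i *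
          (if i ∈ Set.Icc (j₁ : ℕ) (j₁ + n) then (g.map (Int.castRingHom ℂ)).coeff (i - j₁) else 0))
          (m + n),
        sum_pow_mul_sylvester_col (g.map (Int.castRingHom ℂ)) θ (m + n) j₁ n
          (by simp [hn, natDegree_map_intCastRingHom]) (by omega),
        norm_mul, norm_pow, eval_map_intCastRingHom]
      simp only [hE, Fin.addCases_left]
      exact mul_le_mul_of_nonneg_right (hpow j₁ (by omega)) (norm_nonneg _)
    · -- an `f`-column
      have hcol : ∀ i : Fin (m + n), S i (Fin.natAdd m j₁) =
          if (i : ℕ) ∈ Set.Icc (j₁ : ℕ) (j₁ + m) then (f.map (Int.castRingHom ℂ)).coeff (i - j₁)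
          else 0 := fun i => by
        rw [hS, sylvester, Matrix.of_apply, Fin.addCases_right]
      simp_rw [hcol, hv]
      rw [Fin.sum_univ_eq_sum_range (fun i => θ ^ i *
          (if i ∈ Set.Icc (j₁ : ℕ) (j₁ + m) then (f.map (Int.castRingHom ℂ)).coeff (i - j₁) else 0))
          (m + n),
        sum_pow_mul_sylvester_col (f.map (Int.castRingHom ℂ)) θ (m + n) j₁ m
          (by simp [hm, natDegree_map_intCastRingHom]) (by omega),
        norm_mul, norm_pow, eval_map_intCastRingHom]
      simp only [hE, Fin.addCases_right]
      exact mul_le_mul_of_nonneg_right (hpow j₁ (by omega)) (norm_nonneg _)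
  -- cofactor bound
  have hf1 : 1 ≤ f.l1norm := one_le_l1norm_of_ne_zero hf
  have hg1 : 1 ≤ g.l1norm := one_le_l1norm_of_ne_zero hg
  set K₀ : ℝ := f.l1norm ^ n * g.l1norm ^ m with hK₀
  set c : Fin (m + n) → ℝ :=
    Fin.addCases (fun _ : Fin m => g.l1norm) (fun _ : Fin n => f.l1norm) with hc
  have hcolsum : ∀ j, ∑ i, ‖S i j‖ ≤ c j := by
    intro j
    refine Fin.addCases (fun j₁ => ?_) (fun j₁ => ?_) j
    · simp only [hc, Fin.addCases_left]
      have hcol : ∀ i : Fin (m + n), S i (Fin.castAdd n j₁) =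
          if (i : ℕ) ∈ Set.Icc (j₁ : ℕ) (j₁ + n) then (g.map (Int.castRingHom ℂ)).coeff (i - j₁)
          else 0 := fun i => by
        rw [hS, sylvester, Matrix.of_apply, Fin.addCases_left]
      simp_rw [hcol]
      rw [Fin.sum_univ_eq_sum_range (fun i =>
          ‖(if i ∈ Set.Icc (j₁ : ℕ) (j₁ + n) then (g.map (Int.castRingHom ℂ)).coeff (i - j₁) else 0)‖)
          (m + n)]
      exact sum_norm_sylvester_col_le g (m + n) j₁ n hn.ge (by omega)
    · simp only [hc, Fin.addCases_right]
      have hcol : ∀ i : Fin (m + n), S i (Fin.natAdd m j₁) =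
          if (i : ℕ) ∈ Set.Icc (j₁ : ℕ) (j₁ + m) then (f.map (Int.castRingHom ℂ)).coeff (i - j₁)
          else 0 := fun i => by
        rw [hS, sylvester, Matrix.of_apply, Fin.addCases_right]
      simp_rw [hcol]
      rw [Fin.sum_univ_eq_sum_range (fun i =>
          ‖(if i ∈ Set.Icc (j₁ : ℕ) (j₁ + m) then (f.map (Int.castRingHom ℂ)).coeff (i - j₁) else 0)‖)
          (m + n)]
      exact sum_norm_sylvester_col_le f (m + n) j₁ m hm.ge (by omega)
  have hc1 : ∀ j, 1 ≤ c j := fun j => by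
    refine Fin.addCases (fun j₁ => ?_) (fun j₁ => ?_) j
    · simp only [hc, Fin.addCases_left]; exact hg1
    · simp only [hc, Fin.addCases_right]; exact hf1
  have hprod : ∏ j, c j = K₀ := by
    rw [Fin.prod_univ_add]
    simp [hc, hK₀, mul_comm]
  have hadj : ∀ i j, ‖S.adjugate i j‖ ≤ K₀ := by
    intro i j
    refine (Matrix.norm_adjugate_le_prod_erase S i j).trans ?_
    calc ∏ k ∈ Finset.univ.erase i, ∑ i', ‖S i' k‖ ≤ ∏ k ∈ Finset.univ.erase i, c k :=
          Finset.prod_le_prod (fun k _ => Finset.sum_nonneg fun _ _ => norm_nonneg _)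
            fun k _ => hcolsum k
      _ ≤ (∏ k ∈ Finset.univ.erase i, c k) * c i :=
          le_mul_of_one_le_right (Finset.prod_nonneg fun k _ => zero_le_one.trans (hc1 k)) (hc1 i)
      _ = ∏ k, c k := Finset.prod_erase_mul _ _ (Finset.mem_univ i)
      _ = K₀ := hprod
  -- `det S · v = (v S) · adj S`, read off at the index `i0`
  have hkey : (S.det • v) i0 = ((v ᵥ* S) ᵥ* S.adjugate) i0 := by
    rw [Matrix.vecMul_vecMul, Matrix.mul_adjugate, Matrix.vecMul_smul, Matrix.vecMul_one]
  rw [Pi.smul_apply, smul_eq_mul, Matrix.vecMul, dotProduct] at hkey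
  have hsumE : ∑ j, E j = m * ‖aeval θ g‖ + n * ‖aeval θ f‖ := by
    rw [Fin.sum_univ_add]
    simp [hE]
  have hK0 : 0 ≤ K₀ := by positivity
  calc (1 : ℝ) ≤ ‖(R : ℂ)‖ := hR1
    _ = ‖S.det * v i0‖ / ‖v i0‖ := by rw [norm_mul, hdet, mul_div_cancel_right₀ _ hvi0.ne']
    _ = ‖∑ j, (v ᵥ* S) j * S.adjugate j i0‖ / ‖v i0‖ := by rw [hkey]
    _ ≤ (∑ j, ‖v i0‖ * E j * K₀) / ‖v i0‖ := by
        gcongr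
        refine (norm_sum_le _ _).trans (Finset.sum_le_sum fun j _ => ?_)
        rw [norm_mul]
        exact mul_le_mul (hw j) (hadj j i0) (norm_nonneg _) (mul_nonneg (norm_nonneg _) (hE0 j))
    _ = K₀ * ∑ j, E j := by
        rw [Finset.mul_sum]
        rw [Finset.sum_div]
        refine Finset.sum_congr rfl fun j _ => ?_
        field_simp
    _ = _ := by rw [hsumE, hK₀]

end Resultant


/-! ### The comparison step, sharp form -/

/-- The numerical inequality behind the choice of the constant: `y e^{-9y/10} ≤ 1/2` for
`y ≥ 0` (from `e^x ≥ 1 + x + x²/2`). [folklore] -/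
private lemma mul_exp_neg_le_half {y : ℝ} (hy : 0 ≤ y) : y * Real.exp (-(9 / 10 * y)) ≤ 1 / 2 := by
  have h := Real.quadratic_le_exp_of_nonneg (show (0 : ℝ) ≤ 9 / 10 * y by positivity)
  have h2 : 2 * y ≤ Real.exp (9 / 10 * y) := by nlinarith [sq_nonneg (9 * y - 13)]
  rw [Real.exp_neg]
  have hpos : 0 < Real.exp (9 / 10 * y) := Real.exp_pos _
  rw [mul_inv_le_iff₀ hpos]
  linarith

/-- **Comparison step of Gelfond's criterion, sharp form.** Two nonzero integer polynomials of
positive degree which are both very small at `θ` relative to their weights `w_{δ,σ}`,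
`w_{δ',σ'}` (parameters one step apart: `δ ≤ δ' ≤ aδ`, `σ ≤ σ' ≤ aσ`, `δ ≤ σ`), with
`deg Qᵢ + log M(Qᵢ) ≤ (3/2)·σ`, cannot be coprime over `ℚ` as soon as the exponent is
`ρ ≥ 12a/5`: otherwise `resultant_liouville_sharp` is violated. [folklore] -/
theorem not_isCoprime_of_small_sharp {θ : ℂ} {a δ δ' σ σ' ρ : ℝ} {Q₁ Q₂ : ℤ[X]}
    (ha : 1 < a) (hδ : 0 < δ) (hσ : 0 < σ) (hδσ : δ ≤ σ)
    (hδ' : δ ≤ δ') (hσ' : σ ≤ σ') (hδ'a : δ' ≤ a * δ) (hσ'a : σ' ≤ a * σ)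
    (h₁ : Q₁ ≠ 0) (h₂ : Q₂ ≠ 0) (hd₁ : 0 < Q₁.natDegree) (hd₂ : 0 < Q₂.natDegree)
    (hd₁δ : (Q₁.natDegree : ℝ) < δ) (hd₂δ : (Q₂.natDegree : ℝ) < δ')
    (hμ₁ : (Q₁.natDegree : ℝ) + (Q₁.map (Int.castRingHom ℂ)).logMahlerMeasure ≤ 3 / 2 * σ)
    (hμ₂ : (Q₂.natDegree : ℝ) + (Q₂.map (Int.castRingHom ℂ)).logMahlerMeasure ≤ 3 / 2 * σ')
    (hρ : 12 * a / 5 ≤ ρ)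
    (hs₁ : ‖aeval θ Q₁‖ < Real.exp (-ρ * gelfondWeight δ σ Q₁))
    (hs₂ : ‖aeval θ Q₂‖ < Real.exp (-ρ * gelfondWeight δ' σ' Q₂)) :
    ¬ IsCoprime (Q₁.map (Int.castRingHom ℚ)) (Q₂.map (Int.castRingHom ℚ)) := by
  intro hcop
  have hL := resultant_liouville_sharp Q₁ Q₂ θ h₁ h₂ (by omega) hcop
  -- abbreviations
  set d₁ : ℕ := Q₁.natDegree with hd₁def
  set d₂ : ℕ := Q₂.natDegree with hd₂def
  set m₁ : ℝ := (Q₁.map (Int.castRingHom ℂ)).logMahlerMeasure with hm₁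
  set m₂ : ℝ := (Q₂.map (Int.castRingHom ℂ)).logMahlerMeasure with hm₂
  set w₁ : ℝ := gelfondWeight δ σ Q₁ with hw₁def
  set w₂ : ℝ := gelfondWeight δ' σ' Q₂ with hw₂def
  have hw₁ : w₁ = δ * (d₁ + m₁) + σ * d₁ := rfl
  have hw₂ : w₂ = δ' * (d₂ + m₂) + σ' * d₂ := rfl
  have ha0 : 0 < a := by linarith
  have hm₁0 : 0 ≤ m₁ := logMahlerMeasure_map_nonneg h₁
  have hm₂0 : 0 ≤ m₂ := logMahlerMeasure_map_nonneg h₂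
  have hd₁1 : (1 : ℝ) ≤ d₁ := by exact_mod_cast hd₁
  have hd₂1 : (1 : ℝ) ≤ d₂ := by exact_mod_cast hd₂
  have hδ'0 : 0 < δ' := lt_of_lt_of_le hδ hδ'
  have hσ'0 : 0 < σ' := lt_of_lt_of_le hσ hσ'
  -- the `ℓ¹` norms
  have hl₁ : Q₁.l1norm ≤ Real.exp (d₁ + m₁) := l1norm_le_exp h₁
  have hl₂ : Q₂.l1norm ≤ Real.exp (d₂ + m₂) := l1norm_le_exp h₂
  have hl₁0 : 0 ≤ Q₁.l1norm := Q₁.l1norm_nonneg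
  have hl₂0 : 0 ≤ Q₂.l1norm := Q₂.l1norm_nonneg
  set K : ℝ := Q₁.l1norm ^ d₂ * Q₂.l1norm ^ d₁ with hK
  have hKexp : K ≤ Real.exp (d₂ * (d₁ + m₁) + d₁ * (d₂ + m₂)) := by
    rw [Real.exp_add, Real.exp_nat_mul, Real.exp_nat_mul, hK]
    gcongr
  have hK0 : 0 ≤ K := by positivity
  -- the exponent against the two weights
  have hE₁ : (d₂ : ℝ) * (d₁ + m₁) + d₁ * (d₂ + m₂) ≤ 3 / 2 * a * w₁ := by
    have t1 : (d₂ : ℝ) * (d₁ + m₁) ≤ (a * δ) * (d₁ + m₁) :=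
      mul_le_mul_of_nonneg_right (hd₂δ.le.trans hδ'a) (by positivity)
    have t2 : (d₁ : ℝ) * (d₂ + m₂) ≤ d₁ * (3 / 2 * (a * σ)) :=
      mul_le_mul_of_nonneg_left (hμ₂.trans (by linarith)) (by positivity)
    have t3 : 0 ≤ a * δ * (d₁ + m₁) := by positivity
    rw [hw₁]
    linarith
  have hE₂ : (d₂ : ℝ) * (d₁ + m₁) + d₁ * (d₂ + m₂) ≤ 3 / 2 * w₂ := by
    have t1 : (d₂ : ℝ) * (d₁ + m₁) ≤ d₂ * (3 / 2 * σ') :=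
      mul_le_mul_of_nonneg_left (hμ₁.trans (by linarith)) (by positivity)
    have t2 : (d₁ : ℝ) * (d₂ + m₂) ≤ δ' * (d₂ + m₂) :=
      mul_le_mul_of_nonneg_right (hd₁δ.le.trans hδ') (by positivity)
    have t3 : 0 ≤ δ' * (d₂ + m₂) := by positivity
    rw [hw₂]
    linarith
  -- lower bounds for the weights
  have hw₁σ : σ ≤ w₁ := by
    rw [hw₁]
    have : σ ≤ σ * d₁ := le_mul_of_one_le_right hσ.le hd₁1
    have : 0 ≤ δ * (d₁ + m₁) := by positivity
    linarith
  have hw₂σ : σ ≤ w₂ := by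
    rw [hw₂]
    have : σ' ≤ σ' * d₂ := le_mul_of_one_le_right hσ'0.le hd₂1
    have : 0 ≤ δ' * (d₂ + m₂) := by positivity
    linarith
  have hw₁0 : 0 < w₁ := hσ.trans_le hw₁σ
  have hw₂0 : 0 < w₂ := hσ.trans_le hw₂σ
  -- the two halves
  have hhalf := mul_exp_neg_le_half (show 0 ≤ a * σ by positivity)
  have hA : (d₂ : ℝ) * (K * ‖aeval θ Q₁‖) < 1 / 2 := by
    have h1 : K * ‖aeval θ Q₁‖ ≤ Real.exp (-(9 / 10 * (a * σ))) := by
      have h2 : K * ‖aeval θ Q₁‖ ≤ Real.exp (d₂ * (d₁ + m₁) + d₁ * (d₂ + m₂)) *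
          Real.exp (-ρ * w₁) :=
        mul_le_mul hKexp hs₁.le (norm_nonneg _) (Real.exp_pos _).le
      rw [← Real.exp_add] at h2
      refine h2.trans (Real.exp_le_exp.mpr ?_)
      have h3 : 12 * a / 5 * w₁ ≤ ρ * w₁ := mul_le_mul_of_nonneg_right hρ hw₁0.le
      have h4 : a * σ ≤ a * w₁ := mul_le_mul_of_nonneg_left hw₁σ ha0.le
      linarith
    have hd₂a : (d₂ : ℝ) < a * σ := by
      have : a * δ ≤ a * σ := mul_le_mul_of_nonneg_left hδσ ha0.le
      linarith
    calc (d₂ : ℝ) * (K * ‖aeval θ Q₁‖) ≤ d₂ * Real.exp (-(9 / 10 * (a * σ))) := by gcongr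
      _ < a * σ * Real.exp (-(9 / 10 * (a * σ))) := by gcongr
      _ ≤ 1 / 2 := hhalf
  have hB : (d₁ : ℝ) * (K * ‖aeval θ Q₂‖) < 1 / 2 := by
    have h1 : K * ‖aeval θ Q₂‖ ≤ Real.exp (-(9 / 10 * (a * σ))) := by
      have h2 : K * ‖aeval θ Q₂‖ ≤ Real.exp (d₂ * (d₁ + m₁) + d₁ * (d₂ + m₂)) *
          Real.exp (-ρ * w₂) :=
        mul_le_mul hKexp hs₂.le (norm_nonneg _) (Real.exp_pos _).le
      rw [← Real.exp_add] at h2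
      refine h2.trans (Real.exp_le_exp.mpr ?_)
      have h3 : 12 * a / 5 * w₂ ≤ ρ * w₂ := mul_le_mul_of_nonneg_right hρ hw₂0.le
      have h4 : a * σ ≤ a * w₂ := mul_le_mul_of_nonneg_left hw₂σ ha0.le
      have h5 : w₂ ≤ a * w₂ := le_mul_of_one_le_left hw₂0.le ha.le
      linarith
    have hd₁a : (d₁ : ℝ) < a * σ := by
      have : σ ≤ a * σ := le_mul_of_one_le_left hσ.le ha.le
      linarith
    calc (d₁ : ℝ) * (K * ‖aeval θ Q₂‖) ≤ d₁ * Real.exp (-(9 / 10 * (a * σ))) := by gcongr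
      _ < a * σ * Real.exp (-(9 / 10 * (a * σ))) := by gcongr
      _ ≤ 1 / 2 := hhalf
  -- contradiction with the resultant inequality
  have hL' : (1 : ℝ) ≤ d₁ * (K * ‖aeval θ Q₂‖) + d₂ * (K * ‖aeval θ Q₁‖) := by
    have : Q₁.l1norm ^ d₂ * Q₂.l1norm ^ d₁ * (d₁ * ‖aeval θ Q₂‖ + d₂ * ‖aeval θ Q₁‖) =
        d₁ * (K * ‖aeval θ Q₂‖) + d₂ * (K * ‖aeval θ Q₁‖) := by rw [hK]; ring
    rw [← this]
    exact hL
  linarith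

end Polynomial

/-! ### Gelfond's criterion with the printed constant `6` -/

namespace Literature.NumberTheory.Transcendental

/-- Gelfond's criterion with the printed constant `6`, under the harmless normalisation
`δ_N ≤ σ_N` (the general case reduces to this one with `δ_N ↦ min(δ_N, σ_N)`, see
`GelfondCriterion_holds`). The extraction step is run with the exponent `ρ = 12a/5` (the weight
of `P_N` is `< (5/2) δ_N σ_N` by Landau's inequality), and consecutive irreducible factors are
compared with `not_isCoprime_of_small_sharp`. [cite: Chudnovsky1984, Ch. 4 Lemma 1.1 p. 177] -/
theorem gelfond_criterion_six_of_le (θ : ℂ) (a : ℝ) (ha : 1 < a) (δ σ : ℕ → ℝ)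
    (hδm : Monotone δ) (hσm : Monotone σ) (hδ0 : ∀ N, 0 < δ N) (hσ0 : ∀ N, 0 < σ N)
    (hσ : Tendsto σ atTop atTop)
    (hδa : ∀ N, δ (N + 1) ≤ a * δ N) (hσa : ∀ N, σ (N + 1) < a * σ N)
    (hδσ : ∀ N, δ N ≤ σ N) (P : ℕ → ℤ[X]) (N₀ : ℕ)
    (hP : ∀ N, N₀ ≤ N →
      P N ≠ 0 ∧ ((P N).natDegree : ℝ) < δ N ∧ (P N).gelfondType < σ N ∧
        ‖aeval θ (P N)‖ < Real.exp (-6 * a * δ N * σ N)) :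
    IsAlgebraic ℚ θ ∧ ∃ N₁ : ℕ, ∀ N, N₁ ≤ N → aeval θ (P N) = 0 := by
  have ha0 : 0 < a := by linarith
  set ρ : ℝ := 12 * a / 5 with hρ
  have hρ0 : 0 ≤ ρ := by positivity
  -- size facts for `N ≥ N₀`
  have hfacts : ∀ N, N₀ ≤ N → P N ≠ 0 ∧ 0 < (P N).natDegree ∧ ((P N).natDegree : ℝ) < δ N ∧
      ((P N).natDegree : ℝ) + ((P N).map (Int.castRingHom ℂ)).logMahlerMeasure ≤ 3 / 2 * σ N ∧
      ‖aeval θ (P N)‖ < Real.exp (-ρ * gelfondWeight (δ N) (σ N) (P N)) := by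
    intro N hN
    obtain ⟨hP0, hPd, hPt, hPs⟩ := hP N hN
    have hH : 1 ≤ (P N).supNorm := one_le_supNorm_of_ne_zero hP0
    have hlogH : 0 ≤ Real.log (P N).supNorm := Real.log_nonneg hH
    have hδ := hδ0 N
    have hσN := hσ0 N
    unfold Polynomial.gelfondType at hPt
    have hm := logMahlerMeasure_map_le_half hP0
    have h32 : ((P N).natDegree : ℝ) + ((P N).map (Int.castRingHom ℂ)).logMahlerMeasure ≤
        3 / 2 * σ N := by
      have hd0 : (0 : ℝ) ≤ (P N).natDegree := Nat.cast_nonneg _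
      linarith
    refine ⟨hP0, ?_, hPd, h32, ?_⟩
    · by_contra hd
      have hd0 : (P N).natDegree = 0 := by omega
      have h1 := one_le_norm_aeval_of_natDegree_eq_zero hP0 hd0 θ
      have h2 : Real.exp (-6 * a * δ N * σ N) ≤ 1 := Real.exp_le_one_iff.mpr (by
        have : 0 < a * δ N * σ N := by positivity
        linarith)
      linarith
    · refine hPs.trans_le (Real.exp_le_exp.mpr ?_)
      have hw : gelfondWeight (δ N) (σ N) (P N) ≤ 5 / 2 * (δ N * σ N) := by
        unfold gelfondWeight
        have p1 : δ N * (((P N).natDegree : ℝ) + ((P N).map (Int.castRingHom ℂ)).logMahlerMeasure) ≤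
            δ N * (3 / 2 * σ N) := mul_le_mul_of_nonneg_left h32 hδ.le
        have p2 : σ N * ((P N).natDegree : ℝ) ≤ σ N * δ N :=
          mul_le_mul_of_nonneg_left hPd.le hσN.le
        linarith
      have hw' := mul_le_mul_of_nonneg_left hw (show (0 : ℝ) ≤ 12 * a / 5 by positivity)
      rw [hρ]
      linarith
  -- extraction of irreducible factors
  have hex : ∀ N, N₀ ≤ N → ∃ Q : ℤ[X], Irreducible Q ∧ 0 < Q.natDegree ∧ Q ∣ P N ∧
      ‖aeval θ Q‖ < Real.exp (-ρ * gelfondWeight (δ N) (σ N) Q) := by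
    intro N hN
    obtain ⟨hP0, hPd, -, -, hPs⟩ := hfacts N hN
    exact exists_irreducible_dvd_small θ (hδ0 N).le (hσ0 N).le hρ0 (P N) hP0 hPd hPs
  choose! Q hQ using hex
  -- size facts for the factors
  have hQfacts : ∀ N, N₀ ≤ N → Q N ≠ 0 ∧ ((Q N).natDegree : ℝ) < δ N ∧
      ((Q N).natDegree : ℝ) + ((Q N).map (Int.castRingHom ℂ)).logMahlerMeasure ≤ 3 / 2 * σ N := by
    intro N hN
    obtain ⟨hQi, hQd, hQdvd, -⟩ := hQ N hN
    obtain ⟨hP0, -, hPd, hP32, -⟩ := hfacts N hN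
    have h4 : ((Q N).natDegree : ℝ) ≤ (P N).natDegree := by
      exact_mod_cast natDegree_le_of_dvd hQdvd hP0
    refine ⟨hQi.ne_zero, lt_of_le_of_lt h4 hPd, ?_⟩
    have h2 := logMahlerMeasure_map_le_of_dvd hP0 hQdvd
    linarith
  -- consecutive factors are associated
  have hassoc : ∀ N, N₀ ≤ N → Associated (Q N) (Q (N + 1)) := by
    intro N hN
    have hN' : N₀ ≤ N + 1 := Nat.le_succ_of_le hN
    obtain ⟨hQi, hQd, -, hQs⟩ := hQ N hN
    obtain ⟨hQi', hQd', -, hQs'⟩ := hQ (N + 1) hN'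
    obtain ⟨hQ0, hQδ, hQμ⟩ := hQfacts N hN
    obtain ⟨hQ0', hQδ', hQμ'⟩ := hQfacts (N + 1) hN'
    refine associated_of_not_isCoprime hQi hQi' hQd hQd' ?_
    exact not_isCoprime_of_small_sharp ha (hδ0 N) (hσ0 N) (hδσ N) (hδm N.le_succ)
      (hσm N.le_succ) (hδa N) (hσa N).le hQ0 hQ0' hQd hQd' hQδ hQδ' hQμ hQμ' le_rfl hQs hQs'
  -- hence all `Q N`, `N ≥ N₀`, are associated with `Q N₀`
  have hassoc' : ∀ N, N₀ ≤ N → Associated (Q N₀) (Q N) := by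
    intro N hN
    induction N, hN using Nat.le_induction with
    | base => exact Associated.refl _
    | succ N hN ih => exact ih.trans (hassoc N hN)
  -- `Q N₀ (θ) = 0`
  have hzero : aeval θ (Q N₀) = 0 := by
    have hsmall : ∀ N, N₀ ≤ N → ‖aeval θ (Q N₀)‖ ≤ Real.exp (-ρ * σ N) := by
      intro N hN
      obtain ⟨hQi, hQd, -, hQs⟩ := hQ N hN
      rw [norm_aeval_eq_of_associated (hassoc' N hN)]
      refine hQs.le.trans (Real.exp_le_exp.mpr ?_)
      have hw := le_gelfondWeight (hδ0 N).le hQi.ne_zero (σ := σ N)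
      have hd1 : (1 : ℝ) ≤ (Q N).natDegree := by exact_mod_cast hQd
      have hH : 0 ≤ Real.log (Q N).supNorm :=
        Real.log_nonneg (one_le_supNorm_of_ne_zero hQi.ne_zero)
      have hδ := hδ0 N
      have hσ1 := hσ0 N
      have p1 : σ N ≤ σ N * (Q N).natDegree := le_mul_of_one_le_right hσ1.le hd1
      have p2 : 0 ≤ δ N * Real.log (Q N).supNorm := mul_nonneg hδ.le hH
      have hσw : σ N ≤ gelfondWeight (δ N) (σ N) (Q N) := by linarith
      have := mul_le_mul_of_nonneg_left hσw hρ0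
      linarith
    have hlim : Tendsto (fun N => Real.exp (-ρ * σ N)) atTop (nhds 0) := by
      have hρpos : 0 < ρ := by rw [hρ]; positivity
      have h1 : Tendsto (fun N => -(ρ * σ N)) atTop atBot :=
        tendsto_neg_atTop_atBot.comp (hσ.const_mul_atTop hρpos)
      simp_rw [neg_mul]
      exact Real.tendsto_exp_atBot.comp h1
    have h0 : ‖aeval θ (Q N₀)‖ ≤ 0 :=
      le_of_tendsto_of_tendsto tendsto_const_nhds hlim
        (Filter.eventually_atTop.mpr ⟨N₀, hsmall⟩)
    exact norm_le_zero_iff.mp h0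
  obtain ⟨hQ0, -, -⟩ := hQfacts N₀ le_rfl
  refine ⟨⟨(Q N₀).map (algebraMap ℤ ℚ),
    (Polynomial.map_ne_zero_iff (algebraMap ℤ ℚ).injective_int).mpr hQ0,
    by rw [aeval_map_algebraMap, hzero]⟩, N₀, fun N hN => ?_⟩
  obtain ⟨-, -, hQdvd, -⟩ := hQ N hN
  obtain ⟨R, hR⟩ := hQdvd
  have hQN : aeval θ (Q N) = 0 := by
    rw [← norm_eq_zero, ← norm_aeval_eq_of_associated (hassoc' N hN), hzero, norm_zero]
  rw [hR, map_mul, hQN, zero_mul]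

/-- **Gelfond's transcendence criterion with the printed constant** — discharge of the named
fact `GelfondCriterion` (Chudnovsky 1984, Ch. 4, Lemma 1.1, pp. 177–178; Brownawell 1974,
Waldschmidt 1974). Let `θ ∈ ℂ`, `a > 1`, and let `δ_N`, `σ_N` be monotone sequences of positive
reals with `σ_N → ∞`, `δ_{N+1} ≤ aδ_N`, `σ_{N+1} < aσ_N`. If for every `N ≥ N₀` there is a
nonzero `P_N ∈ ℤ[X]` with `deg P_N < δ_N`, `t(P_N) < σ_N` and `|P_N(θ)| < exp(-6aδ_Nσ_N)`, then
`θ` is algebraic and `P_N(θ) = 0` for all large `N`. Proof: replace `δ_N` by `min(δ_N, σ_N)`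
and apply `gelfond_criterion_six_of_le`. [cite: Chudnovsky1984, Ch. 4 Lemma 1.1 p. 177] -/
theorem GelfondCriterion_holds : GelfondCriterion := by
  intro θ a ha δ σ hδm hσm hδ0 hσ0 hσ hδa hσa P N₀ hP
  have ha0 : 0 < a := by linarith
  -- replace `δ` by `min δ σ`
  set δ' : ℕ → ℝ := fun N => min (δ N) (σ N) with hδ'
  refine gelfond_criterion_six_of_le θ a ha δ' σ (fun M N h => min_le_min (hδm h) (hσm h)) hσm
    (fun N => lt_min (hδ0 N) (hσ0 N)) hσ0 hσ (fun N => ?_) hσa (fun N => min_le_right _ _) P N₀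
    (fun N hN => ?_)
  · show min (δ (N + 1)) (σ (N + 1)) ≤ a * min (δ N) (σ N)
    rw [mul_min_of_nonneg _ _ ha0.le]
    exact min_le_min (hδa N) (hσa N).le
  · obtain ⟨hP0, hPd, hPt, hPs⟩ := hP N hN
    have hlogH : 0 ≤ Real.log (P N).supNorm := Real.log_nonneg (one_le_supNorm_of_ne_zero hP0)
    have hPd' : ((P N).natDegree : ℝ) < σ N := by
      unfold Polynomial.gelfondType at hPt; linarith
    refine ⟨hP0, lt_min hPd hPd', hPt, hPs.trans_le (Real.exp_le_exp.mpr ?_)⟩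
    show -6 * a * δ N * σ N ≤ -6 * a * min (δ N) (σ N) * σ N
    have h1 : min (δ N) (σ N) ≤ δ N := min_le_left _ _
    have h2 := hσ0 N
    have h3 : 6 * a * σ N * min (δ N) (σ N) ≤ 6 * a * σ N * δ N :=
      mul_le_mul_of_nonneg_left h1 (by positivity)
    linarith

end Literature.NumberTheory.Transcendental

end
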